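import Summits.CriticalPhenomena.CardyFormulaZ2.Theses.CardyComplexCone
import Literature.Probability.Percolation.InterfaceScalingLimitDiscretised
import Literature.Probability.LatticeModels.MedialExplorationChains
import Literature.Probability.Percolation.LoopRotationInvarianceAssembly

/-!
# Disproof of `ParafermionToSLESixFamilies` (crux stmt-CriticalPhenomena-11389, route CardyComplexCone rev 3) — findings

Standing-disprover work file (refuter, cdisprove mode; `lean check` rc 0, 0 sorry, 0 warnings, axioms
propext / Classical.choice / Quot.sound). Prose lives in docstrings only. VERDICT SO FAR: the crux
RESISTS — it is an implication `A → B → C` whose conclusion C is (up to unbundling) the open named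
conjecture `SLE6LimitZ2AllDiscretisations` (DCS 2012 Conj. 8.8 at q = 1: "All other cases are wide
open. The q = 1 case … is actually bond percolation on the square lattice", arXiv:1109.1549 p. 36), so
`¬ crux ↔ A ∧ B ∧ ¬C` and none of the three conjuncts is decidable in the tree; and it is ONE-SIDED:
in EVERY holomorphic world (δ^{-1/3}F_δ locally uniformly close to ANY holomorphic profile `g_{D,Λ}`,
§5; the zero world §1 is `g = 0`) both hypotheses hold — together with `NonDegenerate` as soon as
`g ≢ 0` (§4–§5) — and the crux IS the bare conjecture: the hypotheses neither exclude degeneration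
nor identify the profile (`oneSided_even_with_nonDegeneracy`).

## Index

* §0 `crux_iff` — the crux is literally `WeakHolFamilies → PrecompactFamilies → SLESixAllFamilies`
  (A → B → C); `slesixAllFamilies_iff_conjecture` — C ↔ `Literature.Probability.Percolation.
  SLE6LimitZ2AllDiscretisations` (unbundle the six `ZdDiscretisationFamily` fields, unfold
  `bondInterfaceIn`/`orientCurve`); `of_conjecture` — C → crux.
* §1 LOAD-BEARING ANALYSIS / ONE-SIDEDNESS. `VanishingFamilies` (the zero world, same guards as the
  crux) ⇒ B (`precompactFamilies_of_vanishing`, C = 1, η = 1) and ⇒ A (`weakHolFamilies_of_vanishing`: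
  `≤ 2(2N+1)²` lattice edges under `tsupport φ ⊆ closedBall 0 R`, `N = ⌈R/δ⌉₊+1`; the observable is
  `≡ 0` off lattice edges, `obs_eq_zero_of_not_mem_edgeSet`, because `medialExploration` is `[]` or a
  genuine exploration whose entries are corner edges); hence
  `crux_iff_conjecture_of_vanishing : VanishingFamilies → (crux ↔ SLE6LimitZ2AllDiscretisations)`.
* §2 HYPOTHESIS MUTATION: no `_false_without_` theorem can exist today — `B → C`, `A → C` and `C` are
  all implied by the conjecture (`cruxWithout…_of_conjecture`) and imply the crux.
* §3 TIGHTNESS OF THE REV-3 REPAIR: with the lattice-edge guards deleted (rev-2 form, stmt-11268)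
  B ⟺ zero world (`precompactUnguarded_iff_vanishing`, non-edge twin `s(a-eᵢ, a+2eᵢ)` of `s(a, a+eᵢ)`,
  same medial point, observable ≡ 0) and the unguarded crux ⟺ (`VanishingFamilies → conjecture`)
  (`cruxUnguarded_iff`). The guard removes the FORCING of the zero world, not its admissibility.
* §4 THE MISSING INPUT, DUALLY: `NonDegenerate` (a δ^{1/3} lower bound at one bulk edge, frequently,
  for one family — the weakest form of DCS Conj. 8.7's `φ' ≠ 0`) is classically `¬ VanishingFamilies`
  (`not_vanishing_of_nonDegenerate`, `nonDegenerate_of_not_vanishing`); so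
  `crux_iff_conjecture_of_not_nonDegenerate : ¬NonDegenerate → (crux ↔ conjecture)`: a proof of the
  crux that is not a proof of Conj. 8.8(q=1) outright must prove `NonDegenerate` (input N) en route —
  DCS p. 36: "The third step [convergence of the observable] … should be the most difficult".
* §5 HOLOMORPHIC WORLDS (sharp one-sidedness): `HoloWorld g` (each `g D Λ` holomorphic on `D`,
  `δ^{-1/3}F_δ` locally uniformly `o(1)`-close to it on lattice edges) ⇒ B
  (`precompactFamilies_of_holoWorld`) and ⇒ A (`weakHolFamilies_of_holoWorld`: DISCRETE INTEGRATION
  BY PARTS `sum_box_mul_sub_eq` on each sublattice of medial points, the Cauchy–Riemann identity of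
  `fderiv ℂ g`, first-order Taylor defects via the moduli of uniform continuity of `fderiv ℝ φ` and
  of `fderiv ℂ g` on a compact thickening of `tsupport φ` inside `D`; no integral is formed); hence
  `crux_iff_conjecture_of_holoWorld : HoloWorld g → (crux ↔ conjecture)` for EVERY profile `g`, and
  `nonDegenerate_of_holoWorld` (a profile non-zero at one point of a domain carrying a family gives N),
  packaged as `oneSided_even_with_nonDegeneracy : HoloWorld g → … → NonDegenerate ∧ A ∧ B ∧ (crux ↔
  conjecture)`. Reading: (A, B) = "subsequential limits of δ^{-1/3}F_δ are holomorphic" and nothing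
  more; N does not help; the IDENTIFICATION `g = 2^{1/3}(φ'_{D,a,b})^{1/3}` with its free-arc boundary
  values (DC 2012 Prop. 5) and slit-domain uniformity is the entire SLE content and must be created
  inside any proof of the crux.

## Attacks that found nothing (why it resists), recorded for the provers

* C is not junk-refutable: its inner hypotheses (`(Λ δ).Ω = D.carrier` open Jordan interior, mesh δ,
  Hausdorff-converging arcs AND marks, eventual `IsZdAdmissible`) pin `medialExploration (Λ δ)` to the
  genuine interface (`existsUnique_medialExploration_holds`, MedialInterfaceProofs), from the A→B to
  the B→A transition edge, one near each marked point (marks hypothesis + `pt_injective`); the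
  orientation device then starts it near `pt 0`; `bondPercolation` is a probability measure
  (instance); the SLE side is real (`exists_isSLECurve_six`; `preWienerMeasure` is junk `0` only if
  the Kolmogorov extension fails, unprovable). Refuting C = computing the law of the ℤ² interface.
* A, B are not junk-refutable: `∑ᶠ` has finite support (observable ≡ 0 off lattice edges; finitely
  many edges under `tsupport φ`), the Bochner integrand is bounded and cylinder-measurable (item
  11269), `K ⊆ D.carrier` is compactly inside the OPEN domain so the marked edges (where
  `‖F_δ(e_a)‖ = 1 ≫ δ^{1/3}`) never lie under `K`; a refutation of B(i) is a two-arm+phase LOWER bound.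
* Paper checks. (i) Holomorphic vs anti-holomorphic convention: `Polyline.turning = arg((z₃-z₂)/(z₂-z₁))`
  is ccw-positive and the phase is `exp(-(i/3)·W(start → z))`; under a conformal change of domain the
  direction factor `dir^{-σ}` picks up `(φ'/|φ'|)^{+σ}` and the passage density `|φ'|^{x}` with
  `x = σ = 1/3` (spin = dimension), i.e. `F_Ω = (φ')^{1/3} F̃∘φ` — HOLOMORPHIC covariance; reversing the
  direction of travel only multiplies by the constant `exp(-iσΘ)` (Θ = total turning, fixed by the
  boundary), so the start-anchored winding of the tree and DCS's end-anchored `W_γ(e, e_b)` agree up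
  to a constant: A is "true in reality" (no vacuity of the crux through a false A). (ii) A and B
  quantify over ALL eventually-admissible families with `Ω = D` (no arc/mark convergence): uniformly
  in the marked points `|Φ'_{a,b}(z)| = π⁻¹|a-b|/(|z-a||z-b|)` (disc picture) stays bounded on
  compacts and `(Φ')^{1/3}` is a normal family, so even that uniformity is plausible — the hypotheses
  are STRONGER than the canonical-arc forms, which only weakens the crux.
* Landing: the gate accepts from refuters only `¬ Theses` files under `Theorems/` (dry-run p∅ bounced
  `theorems.refuter`; flat `Theorems/<Name>.lean` only, ≤ 400 lines), so §§0–4 travel as item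
  evidence (this file), not as `…/Negative/*.lean` modules.
-/

noncomputable section

open scoped Topology ENNReal NNReal BigOperators unitInterval
open Filter Set MeasureTheory
open Literature.Probability.LatticeModels Literature.Probability.Percolation
open Literature.Probability.RandomPlanarGeometry

namespace Summit.CriticalPhenomena.CardyFormulaZ2.Cruxes.ParafermionToSLESixFamilies.Disproof

open Summit.CriticalPhenomena.CardyFormulaZ2.Theses.CardyComplexCone (ParafermionToSLESixFamilies)

/-! ## §0 The three blocks of the crux, verbatim

(`passageSum` is written `MedialPath.passageSum`: the route file, importing only `MedialWinding`,
resolves `Literature.Probability.LatticeModels.passageSum` to that alias, whereas this file's import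
closure also contains `FermionicObservable`'s homonymous real constant; with the explicit name the
blocks are syntactically the route's, see `crux_iff`.) -/

/-- Hypothesis A of the crux (weak holomorphy of the spin-1/3 vertex parafermion at scale δ^{1/3}, family form), verbatim. -/
def WeakHolFamilies : Prop :=
  ∀ (D : Literature.Probability.RandomPlanarGeometry.DobrushinDomain) (Λ : ℝ → Literature.Probability.LatticeModels.DiscreteDobrushin), (∀ δ, (Λ δ).Ω = D.carrier) → (∀ δ, (Λ δ).δ = δ) → (∀ᶠ δ in 𝓝[>] (0:ℝ), (Λ δ).IsZdAdmissible) → ∀ (φ : ℂ → ℂ), ContDiff ℝ (⊤ : ℕ∞) φ → HasCompactSupport φ → tsupport φ ⊆ D.carrier → Tendsto (fun δ : ℝ => ((δ ^ ((5:ℝ) / 3) : ℝ) : ℂ) * ∑ᶠ z : Literature.Probability.LatticeModels.MedialVertex, (∫ ω, Literature.Probability.LatticeModels.MedialPath.passageSum (Literature.Probability.LatticeModels.medialExploration (Λ δ) ω) δ (1 / 3) z ∂(Literature.Probability.Percolation.bondPercolation (Literature.Probability.LatticeModels.zdGraph 2) Literature.Probability.Percolation.half)) * ((fderiv ℝ φ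 (Literature.Probability.LatticeModels.medialPoint δ z) 1 + Complex.I * fderiv ℝ φ (Literature.Probability.LatticeModels.medialPoint δ z) Complex.I) / 2)) (𝓝[>] (0:ℝ)) (𝓝 0)

/-- Hypothesis B of the crux (local boundedness + equicontinuity of δ^{-1/3}F_δ on lattice edges, family form), verbatim. -/
def PrecompactFamilies : Prop :=
  ∀ (D : Literature.Probability.RandomPlanarGeometry.DobrushinDomain) (Λ : ℝ → Literature.Probability.LatticeModels.DiscreteDobrushin), (∀ δ, (Λ δ).Ω = D.carrier) → (∀ δ, (Λ δ).δ = δ) → (∀ᶠ δ in 𝓝[>] (0:ℝ), (Λ δ).IsZdAdmissible) → let F : ℝ → Literature.Probability.LatticeModels.MedialVertex → ℂ := fun δ z => ∫ ω, Literature.Probability.LatticeModels.MedialPath.passageSum (Literature.Probability.LatticeModels.medialExploration (Λ δ) ω) δ (1 / 3) z ∂(Literature.Probability.Percolation.bondPercolation (Literature.Probability.LatticeModels.zdGraph 2) Literature.Probability.Percolation.half); ∀ K : Set ℂ, IsCompact K → K ⊆ D.carrier → (∃ C : ℝ, ∀ᶠ δ in 𝓝[>] (0:ℝ), ∀ z :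 Literature.Probability.LatticeModels.MedialVertex, z ∈ (Literature.Probability.LatticeModels.zdGraph 2).edgeSet → Literature.Probability.LatticeModels.medialPoint δ z ∈ K → ‖F δ z‖ ≤ C * δ ^ ((1:ℝ) / 3)) ∧ (∀ ε > (0:ℝ), ∃ η > (0:ℝ), ∀ᶠ δ in 𝓝[>] (0:ℝ), ∀ z z' : Literature.Probability.LatticeModels.MedialVertex, z ∈ (Literature.Probability.LatticeModels.zdGraph 2).edgeSet → z' ∈ (Literature.Probability.LatticeModels.zdGraph 2).edgeSet → Literature.Probability.LatticeModels.medialPoint δ z ∈ K → Literature.Probability.LatticeModels.medialPoint δ z' ∈ K → dist (Literature.Probability.LatticeModels.medialPoint δ z) (Literature.Probability.LatticeModels.medialPoint δ z') < η → ‖F δ z - F δ z'‖ ≤ ε * δ ^ ((1:ℝ) / 3))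

/-- Conclusion C of the crux (SLE₆ for every Dobrushin domain and every discretisation family), verbatim. -/
def SLESixAllFamilies : Prop :=
  ∀ (D : Literature.Probability.RandomPlanarGeometry.DobrushinDomain) (Λ : ℝ → Literature.Probability.LatticeModels.DiscreteDobrushin), (∀ δ, (Λ δ).Ω = D.carrier) → (∀ δ, (Λ δ).δ = δ) → Tendsto (fun δ : ℝ => Metric.hausdorffEDist (Λ δ).arcA (D.arc 0)) (𝓝[>] (0:ℝ)) (𝓝 0) → Tendsto (fun δ : ℝ => Metric.hausdorffEDist (Λ δ).arcB (D.arc 1)) (𝓝[>] (0:ℝ)) (𝓝 0) → Tendsto (fun δ : ℝ => Metric.hausdorffEDist (Literature.Probability.LatticeModels.medialPoint δ '' (Λ δ).zdABEdges) {D.pt 0, D.pt 1}) (𝓝[>] (0:ℝ)) (𝓝 0) → (∀ᶠ δ in 𝓝[>] (0:ℝ), (Λ δ).IsZdAdmissible) → Literature.Probability.RandomPlanarGeometry.ConvergesInLawToSLE 6 D (Ωδ := fun _ => Literature.Probability.Percolation.BondConfig (Literature.Probability.LatticeModels.Site 2)) (fun δ ω => Literature.Probability.RandomPlanarGeometry.CurveClass.mk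 (if dist (Literature.Probability.LatticeModels.medialExplorationCurve (Λ δ) ω 0) (D.pt 0) ≤ dist (Literature.Probability.LatticeModels.medialExplorationCurve (Λ δ) ω 0) (D.pt 1) then (⟨Literature.Probability.LatticeModels.medialExplorationCurve (Λ δ) ω⟩ : Literature.Probability.RandomPlanarGeometry.Curve ℂ) else ⟨(Literature.Probability.LatticeModels.medialExplorationCurve (Λ δ) ω).comp ⟨unitInterval.symm, unitInterval.continuous_symm⟩⟩)) (fun _ => Literature.Probability.Percolation.bondPercolation (Literature.Probability.LatticeModels.zdGraph 2) Literature.Probability.Percolation.half)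


/-- The crux is literally `A → B → C`. -/
theorem crux_iff :
    ParafermionToSLESixFamilies ↔ (WeakHolFamilies → PrecompactFamilies → SLESixAllFamilies) := by
  unfold ParafermionToSLESixFamilies WeakHolFamilies PrecompactFamilies SLESixAllFamilies
  exact Iff.rfl

/-- The conclusion block C is the open named conjecture `SLE6LimitZ2AllDiscretisations`
(`@[conjecture]`, InterfaceScalingLimitDiscretised.lean), unbundled. -/
theorem slesixAllFamilies_iff_conjecture :
    SLESixAllFamilies ↔ Literature.Probability.Percolation.SLE6LimitZ2AllDiscretisations := by
  constructor
  · intro h D E hE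
    exact h D E hE.Ω_eq hE.δ_eq hE.tendsto_arcA hE.tendsto_arcB hE.tendsto_zdABEdges
      hE.eventually_isZdAdmissible
  · intro h D E h1 h2 h3 h4 h5 h6
    exact h D E ⟨h1, h2, h3, h4, h5, h6⟩

/-- C → crux: the crux is implied outright by the bare conjecture (both hypotheses unused). -/
theorem of_conjecture (h : Literature.Probability.Percolation.SLE6LimitZ2AllDiscretisations) :
    ParafermionToSLESixFamilies :=
  fun _ _ => slesixAllFamilies_iff_conjecture.2 h


/-! ## §1 One-sidedness: the zero world satisfies both hypotheses -/

/-- The spin-1/3 vertex parafermion of the family member `E` at mesh `δ` (definitionally the `F δ z`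
of the blocks when `E = Λ δ`). -/
def obs (E : DiscreteDobrushin) (δ : ℝ) (z : MedialVertex) : ℂ :=
  ∫ ω, Literature.Probability.LatticeModels.MedialPath.passageSum (medialExploration E ω) δ (1 / 3) z
    ∂(bondPercolation (zdGraph 2) half)

/-- THE ZERO WORLD: `δ^{-1/3} F_δ → 0` uniformly on the lattice edges over every compact of the domain,
for every Dobrushin domain and every discretisation family (same guards as the hypotheses of the
crux). Conjecturally FALSE (DCS 2012 Conj. 8.7 predicts a non-zero limit `c·(φ′)^{1/3}`), but not
refutable with anything in the tree: a refutation is a two-arm + winding-phase LOWER bound. -/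
def VanishingFamilies : Prop :=
  ∀ (D : DobrushinDomain) (Λ : ℝ → DiscreteDobrushin), (∀ δ, (Λ δ).Ω = D.carrier) →
    (∀ δ, (Λ δ).δ = δ) → (∀ᶠ δ in 𝓝[>] (0:ℝ), (Λ δ).IsZdAdmissible) →
    ∀ K : Set ℂ, IsCompact K → K ⊆ D.carrier → ∀ ε > (0:ℝ), ∀ᶠ δ in 𝓝[>] (0:ℝ),
      ∀ z : MedialVertex, z ∈ (zdGraph 2).edgeSet → medialPoint δ z ∈ K →
        ‖obs (Λ δ) δ z‖ ≤ ε * δ ^ ((1:ℝ) / 3)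

/-- In the zero world hypothesis B (precompactness) holds: bound `C = 1`, modulus `η = 1`. -/
theorem precompactFamilies_of_vanishing (hV : VanishingFamilies) : PrecompactFamilies := by
  intro D Λ hΩ hδ hadm F K hK hKD
  refine ⟨⟨1, ?_⟩, ?_⟩
  · filter_upwards [hV D Λ hΩ hδ hadm K hK hKD 1 one_pos] with δ h z hz hzK
    exact h z hz hzK
  · intro ε hε
    refine ⟨1, one_pos, ?_⟩
    filter_upwards [hV D Λ hΩ hδ hadm K hK hKD (ε / 2) (half_pos hε)] with δ h z z' hz hz' hzK hz'K _
    calc ‖F δ z - F δ z'‖ ≤ ‖F δ z‖ + ‖F δ z'‖ := norm_sub_le _ _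
      _ ≤ ε / 2 * δ ^ ((1:ℝ) / 3) + ε / 2 * δ ^ ((1:ℝ) / 3) := add_le_add (h z hz hzK) (h z' hz' hz'K)
      _ = ε * δ ^ ((1:ℝ) / 3) := by ring

/-! ### Lattice bookkeeping for hypothesis A -/

/-- Every medial vertex visited by `medialExploration` is a lattice edge (the path is `[]` or a
genuine exploration, whose entries are sources/targets of medial darts). -/
theorem mem_edgeSet_of_mem_medialExploration (E : DiscreteDobrushin) (ω : BondConfig (Site 2))
    {z : MedialVertex} (hz : z ∈ medialExploration E ω) : z ∈ (zdGraph 2).edgeSet := by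
  rcases medialExploration_eq_nil_or E ω with h | h
  · rw [h] at hz; simp at hz
  · generalize hγ : medialExploration E ω = γ at h hz
    have hlen : 2 ≤ γ.length := by
      rcases γ with _ | ⟨a, _ | ⟨b, l⟩⟩
      · exact absurd rfl h.ne_nil
      · exact absurd rfl h.head_ne_getLast
      · simp
    obtain ⟨p, hp, hep⟩ := exists_mem_zip_of_mem γ hlen hz
    obtain ⟨v, f, hvf, -, hs, ht⟩ := h.step p.1 p.2 (infix_of_mem_zip_tail γ hp)
    rcases hep with rfl | rfl
    · rw [← hs]; exact cornerSource_mem_edgeSet hvf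
    · rw [← ht]; exact cornerTarget_mem_edgeSet hvf

/-- Off the lattice edges the observable vanishes identically (any data, any mesh). -/
theorem obs_eq_zero_of_not_mem_edgeSet (E : DiscreteDobrushin) (δ : ℝ) {z : MedialVertex}
    (hz : z ∉ (zdGraph 2).edgeSet) : obs E δ z = 0 := by
  have : ∀ ω, Literature.Probability.LatticeModels.MedialPath.passageSum
      (medialExploration E ω) δ (1 / 3) z = 0 := fun ω =>
    MedialPath.passageSum_eq_zero_of_not_mem _ _
      (fun hmem => hz (mem_edgeSet_of_mem_medialExploration E ω hmem))
  simp only [obs, this, integral_zero]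

/-- A lattice edge is `s(a, a + eᵢ)` for some site `a` and direction `i`. -/
theorem exists_eq_mk_add_single {z : MedialVertex} (hz : z ∈ (zdGraph 2).edgeSet) :
    ∃ (a : Site 2) (i : Fin 2), z = s(a, a + Pi.single i 1) := by
  induction z using Sym2.ind with
  | h x y =>
    rw [SimpleGraph.mem_edgeSet] at hz
    obtain ⟨i, h | h⟩ := (zdGraph_adj_iff x y).1 hz
    · exact ⟨x, i, by rw [h]⟩
    · exact ⟨y, i, by rw [h, Sym2.eq_swap]⟩

/-- The lattice edge `s(a, a + eᵢ)` attached to the site `a` in direction `i` (a parametrisation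
of the lattice edges by `Site 2 × Fin 2`, `latEdge_injective`, `exists_eq_mk_add_single`). -/
def latEdge (p : Site 2 × Fin 2) : MedialVertex := s(p.1, p.1 + Pi.single p.2 1)

theorem latEdge_mem_edgeSet (p : Site 2 × Fin 2) : latEdge p ∈ (zdGraph 2).edgeSet := by
  rw [latEdge, SimpleGraph.mem_edgeSet, zdGraph_adj_iff]
  exact ⟨p.2, Or.inl rfl⟩

theorem latEdge_injective : Function.Injective latEdge := by
  rintro ⟨a, i⟩ ⟨b, j⟩ h
  simp only [latEdge, Sym2.eq_iff] at h
  rcases h with ⟨rfl, h2⟩ | ⟨h1, h2⟩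
  · have hij : i = j := by
      by_contra hij
      have := congr_fun (add_left_cancel h2) i
      rw [Pi.single_eq_same, Pi.single_eq_of_ne hij] at this
      exact one_ne_zero this
    subst hij; rfl
  · exfalso
    have h3 : b + Pi.single j (1:ℤ) + Pi.single i 1 = b := by rw [← h1]; exact h2
    have := congr_fun h3 i
    simp only [Pi.add_apply, Pi.single_eq_same] at this
    rcases eq_or_ne i j with rfl | hij
    · rw [Pi.single_eq_same] at this; omega
    · rw [Pi.single_eq_of_ne hij] at this; omega

/-- The box `[-N, N]²` of sites. -/
def box (N : ℕ) : Finset (Site 2) := Fintype.piFinset fun _ : Fin 2 => Finset.Icc (-(N : ℤ)) N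

theorem card_box (N : ℕ) : (box N).card = (2 * N + 1) ^ 2 := by
  rw [box, Fintype.card_piFinset, Finset.prod_const, Finset.card_univ, Fintype.card_fin, Int.card_Icc]
  congr 1
  omega

/-- The lattice edges `s(a, a + eᵢ)` with `a` in the box `[-N, N]²`, as a finset. -/
def edgesInBox (N : ℕ) : Finset MedialVertex :=
  (box N ×ˢ (Finset.univ : Finset (Fin 2))).image latEdge

theorem card_edgesInBox_le (N : ℕ) : ((edgesInBox N).card : ℝ) ≤ 2 * (2 * N + 1) ^ 2 := by
  have h : (edgesInBox N).card ≤ (2 * N + 1) ^ 2 * 2 := by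
    refine (Finset.card_image_le).trans ?_
    rw [Finset.card_product, card_box, Finset.card_univ, Fintype.card_fin]
  have h' : ((edgesInBox N).card : ℝ) ≤ (((2 * N + 1) ^ 2 * 2 : ℕ) : ℝ) := by exact_mod_cast h
  refine h'.trans (le_of_eq ?_)
  push_cast; ring

/-- A sum over `edgesInBox N` is a sum over the parametrising box. -/
theorem sum_edgesInBox (N : ℕ) (f : MedialVertex → ℂ) :
    ∑ z ∈ edgesInBox N, f z = ∑ p ∈ box N ×ˢ (Finset.univ : Finset (Fin 2)), f (latEdge p) :=
  Finset.sum_image fun _ _ _ _ h => latEdge_injective h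

/-- An edge `s(a, a + eᵢ)` whose midpoint at mesh `δ > 0` lies in `closedBall 0 R` has
`a ∈ [-N, N]²` with `N = ⌈R/δ⌉₊ + 1`. -/
theorem mem_box_of_norm_medialPoint_le {δ R : ℝ} (hδ : 0 < δ) {a : Site 2} {i : Fin 2}
    (h : ‖medialPoint δ s(a, a + Pi.single i 1)‖ ≤ R) :
    a ∈ box (⌈R / δ⌉₊ + 1) := by
  set N : ℕ := ⌈R / δ⌉₊ + 1 with hN
  -- coordinates of the midpoint
  have key : ∀ (c t : ℝ), (t = 1 ∨ t = 0) → |δ * c + δ * t / 2| ≤ R → |c| ≤ R / δ + 1 / 2 := by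
    intro c t ht hc
    have h1 : |δ * c| ≤ R + δ / 2 := by
      have : |δ * t / 2| ≤ δ / 2 := by
        rcases ht with rfl | rfl
        · rw [abs_of_nonneg (by positivity)]; linarith
        · simp; positivity
      calc |δ * c| = |(δ * c + δ * t / 2) - δ * t / 2| := by ring_nf
        _ ≤ |δ * c + δ * t / 2| + |δ * t / 2| := abs_sub _ _
        _ ≤ R + δ / 2 := add_le_add hc this
    rw [abs_mul, abs_of_pos hδ] at h1
    rw [div_add_div _ _ hδ.ne' two_ne_zero, le_div_iff₀ (by positivity)]
    nlinarith
  have hsingle : ∀ j : Fin 2, (((Pi.single i (1:ℤ) : Site 2) j : ℤ) : ℝ) = 1 ∨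
      (((Pi.single i (1:ℤ) : Site 2) j : ℤ) : ℝ) = 0 := by
    intro j
    rcases eq_or_ne j i with rfl | hji
    · left; simp
    · right; simp [Pi.single_eq_of_ne hji]
  have hre : (medialPoint δ s(a, a + Pi.single i 1)).re =
      δ * (a 0 : ℝ) + δ * (((Pi.single i (1:ℤ) : Site 2) 0 : ℤ) : ℝ) / 2 := by
    rw [medialPoint_mk, Complex.div_ofNat_re, Complex.add_re, meshPoint_re, meshPoint_re, Pi.add_apply]
    push_cast
    ring
  have him : (medialPoint δ s(a, a + Pi.single i 1)).im =
      δ * (a 1 : ℝ) + δ * (((Pi.single i (1:ℤ) : Site 2) 1 : ℤ) : ℝ) / 2 := by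
    rw [medialPoint_mk, Complex.div_ofNat_im, Complex.add_im, meshPoint_im, meshPoint_im, Pi.add_apply]
    push_cast
    ring
  have h0 : |(a 0 : ℝ)| ≤ R / δ + 1 / 2 :=
    key _ _ (hsingle 0) (hre ▸ (Complex.abs_re_le_norm _).trans h)
  have h1 : |(a 1 : ℝ)| ≤ R / δ + 1 / 2 :=
    key _ _ (hsingle 1) (him ▸ (Complex.abs_im_le_norm _).trans h)
  have hNR : R / δ + 1 / 2 ≤ (N : ℝ) := by
    rw [hN]; push_cast
    linarith [Nat.le_ceil (R / δ)]
  have hcoord : ∀ j : Fin 2, |(a j : ℝ)| ≤ R / δ + 1 / 2 → a j ∈ Finset.Icc (-(N : ℤ)) N := by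
    intro j hj
    have hj' := (abs_le.1 (hj.trans hNR))
    rw [Finset.mem_Icc]
    exact ⟨by exact_mod_cast hj'.1, by exact_mod_cast hj'.2⟩
  rw [box, Fintype.mem_piFinset]
  intro j
  fin_cases j
  · exact hcoord 0 h0
  · exact hcoord 1 h1

/-- Hence such an edge belongs to `edgesInBox N`. -/
theorem mem_edgesInBox {δ R : ℝ} (hδ : 0 < δ) {a : Site 2} {i : Fin 2}
    (h : ‖medialPoint δ s(a, a + Pi.single i 1)‖ ≤ R) :
    s(a, a + Pi.single i 1) ∈ edgesInBox (⌈R / δ⌉₊ + 1) := by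
  unfold edgesInBox
  rw [Finset.mem_image]
  exact ⟨(a, i), Finset.mem_product.2 ⟨mem_box_of_norm_medialPoint_le hδ h, Finset.mem_univ _⟩, rfl⟩


/-- In the zero world hypothesis A (weak holomorphy) holds: there are `≤ 2(2N+1)²`, `N = ⌈R/δ⌉₊ + 1`,
lattice edges under `tsupport φ ⊆ closedBall 0 R`, the observable vanishes off lattice edges, each
term is `≤ ε' δ^{1/3} ‖∂̄φ‖_∞`, and `δ^{5/3} · δ^{1/3} · (2N+1)² = O(1)`. -/
theorem weakHolFamilies_of_vanishing (hV : VanishingFamilies) : WeakHolFamilies := by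
  intro D Λ hΩ hδ hadm φ hφ hφc hφD
  -- the compact `tsupport φ` and a ball containing it
  have hK : IsCompact (tsupport φ) := hφc
  obtain ⟨R₀, hR₀⟩ := hK.isBounded.subset_closedBall (0 : ℂ)
  set R : ℝ := max R₀ 0 with hRdef
  have hR : tsupport φ ⊆ Metric.closedBall (0:ℂ) R :=
    hR₀.trans (Metric.closedBall_subset_closedBall (le_max_left _ _))
  have hR0 : 0 ≤ R := le_max_right _ _
  -- a uniform bound on the derivative
  obtain ⟨M, hM⟩ : ∃ M, ∀ x, ‖fderiv ℝ φ x‖ ≤ M :=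
    (hφ.continuous_fderiv (by simp)).bounded_above_of_compact_support (hφc.fderiv (𝕜 := ℝ))
  have hM0 : 0 ≤ M := (norm_nonneg _).trans (hM 0)
  -- the weight `∂̄φ (z_δ)` (up to the factor 2)
  set w : ℝ → MedialVertex → ℂ := fun δ z =>
    (fderiv ℝ φ (medialPoint δ z) 1 + Complex.I * fderiv ℝ φ (medialPoint δ z) Complex.I) / 2 with hw
  have hw_norm : ∀ δ z, ‖w δ z‖ ≤ M := by
    intro δ z
    have h1 : ‖fderiv ℝ φ (medialPoint δ z) 1‖ ≤ M := by
      refine (ContinuousLinearMap.le_opNorm _ _).trans ?_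
      simpa using hM (medialPoint δ z)
    have h2 : ‖Complex.I * fderiv ℝ φ (medialPoint δ z) Complex.I‖ ≤ M := by
      rw [norm_mul, Complex.norm_I, one_mul]
      refine (ContinuousLinearMap.le_opNorm _ _).trans ?_
      simpa using hM (medialPoint δ z)
    have h3 : ‖fderiv ℝ φ (medialPoint δ z) 1 + Complex.I * fderiv ℝ φ (medialPoint δ z) Complex.I‖
        ≤ M + M := (norm_add_le _ _).trans (add_le_add h1 h2)
    calc ‖w δ z‖ = ‖fderiv ℝ φ (medialPoint δ z) 1 +
          Complex.I * fderiv ℝ φ (medialPoint δ z) Complex.I‖ / 2 := by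
          simp only [hw, norm_div, Complex.norm_ofNat]
      _ ≤ (M + M) / 2 := by gcongr
      _ = M := by ring
  have hw_supp : ∀ δ z, w δ z ≠ 0 → medialPoint δ z ∈ tsupport φ := by
    intro δ z hz
    by_contra hnot
    apply hz
    have h0 : fderiv ℝ φ (medialPoint δ z) = 0 := fderiv_of_notMem_tsupport ℝ hnot
    simp [hw, h0]
  -- ε-management
  rw [Metric.tendsto_nhds]
  intro ε hε
  set Cst : ℝ := 2 * (2 * R + 5) ^ 2 * (M + 1) with hCst
  have hCst0 : 0 < Cst := by positivity
  have hε' : 0 < ε / (2 * Cst) := by positivity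
  filter_upwards [hV D Λ hΩ hδ hadm (tsupport φ) hK hφD (ε / (2 * Cst)) hε',
    Ioo_mem_nhdsGT (zero_lt_one' ℝ)] with δ hVδ hδI
  obtain ⟨hδ0, hδ1⟩ := hδI
  rw [dist_zero_right]
  set N : ℕ := ⌈R / δ⌉₊ + 1 with hN
  set c : ℝ := ε / (2 * Cst) * δ ^ ((1:ℝ) / 3) * M with hc
  have hc0 : 0 ≤ c := by positivity
  -- termwise bound, valid for every medial vertex
  have hterm : ∀ z : MedialVertex, ‖obs (Λ δ) δ z * w δ z‖ ≤ c := by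
    intro z
    by_cases hwz : w δ z = 0
    · rw [hwz, mul_zero, norm_zero]; exact hc0
    by_cases hz : z ∈ (zdGraph 2).edgeSet
    · rw [norm_mul]
      exact mul_le_mul (hVδ z hz (hw_supp δ z hwz)) (hw_norm δ z) (norm_nonneg _) (by positivity)
    · rw [obs_eq_zero_of_not_mem_edgeSet (Λ δ) δ hz, zero_mul, norm_zero]; exact hc0
  -- the support lies in `edgesInBox N`
  have hsupp : Function.support (fun z => obs (Λ δ) δ z * w δ z) ⊆
      ((edgesInBox N : Finset MedialVertex) : Set MedialVertex) := by
    intro z hz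
    rw [Function.mem_support, mul_ne_zero_iff] at hz
    obtain ⟨hobs, hwz⟩ := hz
    have hzE : z ∈ (zdGraph 2).edgeSet := by
      by_contra h; exact hobs (obs_eq_zero_of_not_mem_edgeSet (Λ δ) δ h)
    obtain ⟨a, i, rfl⟩ := exists_eq_mk_add_single hzE
    have hin : medialPoint δ s(a, a + Pi.single i 1) ∈ Metric.closedBall (0:ℂ) R :=
      hR (hw_supp δ _ hwz)
    rw [Metric.mem_closedBall, dist_zero_right] at hin
    exact mem_edgesInBox hδ0 hin
  have hsum : (∑ᶠ z, obs (Λ δ) δ z * w δ z) = ∑ z ∈ edgesInBox N, obs (Λ δ) δ z * w δ z :=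
    finsum_eq_finsetSum_of_support_subset _ hsupp
  -- the count against the mesh
  have hδN : δ * (2 * (N:ℝ) + 1) ≤ 2 * R + 5 := by
    have hceil : (⌈R / δ⌉₊ : ℝ) < R / δ + 1 := Nat.ceil_lt_add_one (by positivity)
    have hN' : (N : ℝ) < R / δ + 2 := by rw [hN]; push_cast; linarith
    have h' : δ * (N:ℝ) ≤ R + 2 * δ := by
      have := mul_le_mul_of_nonneg_left hN'.le hδ0.le
      rw [mul_add, mul_div_cancel₀ _ hδ0.ne'] at this
      linarith
    nlinarith
  have hδN0 : 0 ≤ δ * (2 * (N:ℝ) + 1) := by positivity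
  have hnormsum : ‖∑ z ∈ edgesInBox N, obs (Λ δ) δ z * w δ z‖ ≤ 2 * (2 * (N:ℝ) + 1) ^ 2 * c := by
    refine (norm_sum_le _ _).trans ?_
    refine (Finset.sum_le_card_nsmul _ _ c fun z _ => hterm z).trans ?_
    rw [nsmul_eq_mul]
    exact mul_le_mul_of_nonneg_right (card_edgesInBox_le N) hc0
  have hpow : δ ^ ((5:ℝ) / 3) * δ ^ ((1:ℝ) / 3) = δ ^ 2 := by
    rw [← Real.rpow_add hδ0, show (5:ℝ) / 3 + 1 / 3 = 2 by norm_num, Real.rpow_two]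
  calc ‖((δ ^ ((5:ℝ) / 3) : ℝ) : ℂ) * ∑ᶠ z, obs (Λ δ) δ z * w δ z‖
      = δ ^ ((5:ℝ) / 3) * ‖∑ z ∈ edgesInBox N, obs (Λ δ) δ z * w δ z‖ := by
        rw [norm_mul, hsum, Complex.norm_real, Real.norm_eq_abs,
          abs_of_nonneg (Real.rpow_nonneg hδ0.le _)]
    _ ≤ δ ^ ((5:ℝ) / 3) * (2 * (2 * (N:ℝ) + 1) ^ 2 * c) :=
        mul_le_mul_of_nonneg_left hnormsum (Real.rpow_nonneg hδ0.le _)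
    _ = (δ ^ ((5:ℝ) / 3) * δ ^ ((1:ℝ) / 3)) * (2 * (N:ℝ) + 1) ^ 2 * (ε / Cst) * M := by
        rw [hc]; ring
    _ = (δ * (2 * (N:ℝ) + 1)) ^ 2 * (ε / Cst * M) := by rw [hpow]; ring
    _ ≤ (2 * R + 5) ^ 2 * (ε / Cst * M) := by
        refine mul_le_mul_of_nonneg_right ?_ (by positivity)
        exact pow_le_pow_left₀ hδN0 hδN 2
    _ = ε * (M / (2 * (M + 1))) := by
        rw [hCst]; field_simp
    _ < ε := by
        have h2 : M / (2 * (M + 1)) < 1 := by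
          rw [div_lt_one (by positivity)]; linarith
        calc ε * (M / (2 * (M + 1))) < ε * 1 := by gcongr
          _ = ε := mul_one ε

/-- ONE-SIDEDNESS, formally: in the zero world the crux is exactly the bare conjecture
`SLE6LimitZ2AllDiscretisations` (SLE₆ for every Dobrushin domain and every discretisation family,
DCS 2012 Conj. 8.8 at q = 1). Hence any proof of the crux proves
`VanishingFamilies → SLE6LimitZ2AllDiscretisations`: it must either refute the zero world (a
non-degeneracy LOWER bound for the parafermion, the missing normalisation input N) or prove the
conjecture outright. -/
theorem crux_iff_conjecture_of_vanishing (hV : VanishingFamilies) :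
    ParafermionToSLESixFamilies ↔ Literature.Probability.Percolation.SLE6LimitZ2AllDiscretisations :=
  ⟨fun h => slesixAllFamilies_iff_conjecture.1
      (crux_iff.1 h (weakHolFamilies_of_vanishing hV) (precompactFamilies_of_vanishing hV)),
    of_conjecture⟩

/-- The same reading as an implication: the crux transports the zero world to the conjecture. -/
theorem conjecture_of_crux_of_vanishing (h : ParafermionToSLESixFamilies) (hV : VanishingFamilies) :
    Literature.Probability.Percolation.SLE6LimitZ2AllDiscretisations :=
  (crux_iff_conjecture_of_vanishing hV).1 h


/-! ## §2 Hypothesis mutation: why there is no `_false_without_` theorem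

Dropping either hypothesis only moves the crux closer to the conjecture C, which implies every
variant; so no hypothesis-dropped variant is refutable unless C is (and C is DCS 2012 Conj. 8.8 at
q = 1, whose inner hypotheses pin the genuine percolation interface: `existsUnique_medialExploration_holds`). -/

/-- The crux without hypothesis A (weak holomorphy): `B → C`. -/
def CruxWithoutWeakHol : Prop := PrecompactFamilies → SLESixAllFamilies

/-- The crux without hypothesis B (precompactness): `A → C`. -/
def CruxWithoutPrecompact : Prop := WeakHolFamilies → SLESixAllFamilies

/-- `C →` (crux without A): not refutable today. -/
theorem cruxWithoutWeakHol_of_conjecture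
    (h : Literature.Probability.Percolation.SLE6LimitZ2AllDiscretisations) : CruxWithoutWeakHol :=
  fun _ => slesixAllFamilies_iff_conjecture.2 h

/-- `C →` (crux without B): not refutable today. -/
theorem cruxWithoutPrecompact_of_conjecture
    (h : Literature.Probability.Percolation.SLE6LimitZ2AllDiscretisations) : CruxWithoutPrecompact :=
  fun _ => slesixAllFamilies_iff_conjecture.2 h

/-- Both mutilated cruxes imply the crux (monotonicity), so they are at least as hard. -/
theorem crux_of_cruxWithoutWeakHol (h : CruxWithoutWeakHol) : ParafermionToSLESixFamilies :=
  fun _ hB => h hB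

theorem crux_of_cruxWithoutPrecompact (h : CruxWithoutPrecompact) : ParafermionToSLESixFamilies :=
  fun hA _ => h hA

/-! ## §3 Tightness of the rev-3 repair: the lattice-edge guard in B is necessary

Rev 2 of the item (stmt-11268, refuted-misstated) stated clause (ii) of B over ALL
`z z' : MedialVertex = Sym2 (Site 2)`. The non-edge twin `s(a - eᵢ, a + 2eᵢ)` of the edge
`s(a, a + eᵢ)` has the same medial point and observable `≡ 0`, so the unguarded clause forces the
zero world; conversely the zero world gives the unguarded B. Hence UNGUARDED B ⟺ `VanishingFamilies`,
and the unguarded crux ⟺ (`VanishingFamilies → C`): re-introducing the unguarded form would re-create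
the degeneration. (Re-proved here over the rev-3 vocabulary `medialExploration`/`MedialPath.passageSum`.) -/

/-- Hypothesis B with the four lattice-edge guards deleted (the rev-2 form). -/
def PrecompactFamiliesUnguarded : Prop :=
  ∀ (D : Literature.Probability.RandomPlanarGeometry.DobrushinDomain) (Λ : ℝ → Literature.Probability.LatticeModels.DiscreteDobrushin), (∀ δ, (Λ δ).Ω = D.carrier) → (∀ δ, (Λ δ).δ = δ) → (∀ᶠ δ in 𝓝[>] (0:ℝ), (Λ δ).IsZdAdmissible) → let F : ℝ → Literature.Probability.LatticeModels.MedialVertex → ℂ := fun δ z => ∫ ω, Literature.Probability.LatticeModels.MedialPath.passageSum (Literature.Probability.LatticeModels.medialExploration (Λ δ) ω) δ (1 / 3) z ∂(Literature.Probability.Percolation.bondPercolation (Literature.Probability.LatticeModels.zdGraph 2) Literature.Probability.Percolation.half); ∀ K : Set ℂ, IsCompact K → K ⊆ D.carrier → (∃ C : ℝ, ∀ᶠ δ in 𝓝[>] (0:ℝ), ∀ z : Literature.Probability.LatticeModels.MedialVertex, Literature.Probability.LatticeModels.medialPoint δ z ∈ K → ‖F δ z‖ ≤ C * δ ^ ((1:ℝ)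 / 3)) ∧ (∀ ε > (0:ℝ), ∃ η > (0:ℝ), ∀ᶠ δ in 𝓝[>] (0:ℝ), ∀ z z' : Literature.Probability.LatticeModels.MedialVertex, Literature.Probability.LatticeModels.medialPoint δ z ∈ K → Literature.Probability.LatticeModels.medialPoint δ z' ∈ K → dist (Literature.Probability.LatticeModels.medialPoint δ z) (Literature.Probability.LatticeModels.medialPoint δ z') < η → ‖F δ z - F δ z'‖ ≤ ε * δ ^ ((1:ℝ) / 3))

/-- The non-edge twin of the edge `s(a, a + eᵢ)`: same medial point, never a lattice edge. -/
def twin (a : Site 2) (i : Fin 2) : MedialVertex :=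
  s(a - Pi.single i 1, a + Pi.single i 1 + Pi.single i 1)

theorem medialPoint_twin (δ : ℝ) (a : Site 2) (i : Fin 2) :
    medialPoint δ (twin a i) = medialPoint δ s(a, a + Pi.single i 1) := by
  apply Complex.ext
  · rw [twin, medialPoint_mk, medialPoint_mk, Complex.div_ofNat_re, Complex.div_ofNat_re,
      Complex.add_re, Complex.add_re, meshPoint_re, meshPoint_re, meshPoint_re, meshPoint_re]
    simp only [Pi.add_apply, Pi.sub_apply]
    push_cast; ring
  · rw [twin, medialPoint_mk, medialPoint_mk, Complex.div_ofNat_im, Complex.div_ofNat_im,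
      Complex.add_im, Complex.add_im, meshPoint_im, meshPoint_im, meshPoint_im, meshPoint_im]
    simp only [Pi.add_apply, Pi.sub_apply]
    push_cast; ring

theorem twin_not_mem_edgeSet (a : Site 2) (i : Fin 2) : twin a i ∉ (zdGraph 2).edgeSet := by
  rw [twin, SimpleGraph.mem_edgeSet, zdGraph_adj_iff]
  rintro ⟨j, h | h⟩
  · have := congr_fun h i
    simp only [Pi.add_apply, Pi.sub_apply, Pi.single_eq_same] at this
    rcases eq_or_ne i j with rfl | hij
    · simp only [Pi.single_eq_same] at this; omega
    · rw [Pi.single_eq_of_ne hij] at this; omega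
  · have := congr_fun h i
    simp only [Pi.add_apply, Pi.sub_apply, Pi.single_eq_same] at this
    rcases eq_or_ne i j with rfl | hij
    · simp only [Pi.single_eq_same] at this; omega
    · rw [Pi.single_eq_of_ne hij] at this; omega

/-- Unguarded B forces the zero world (the rev-2 degeneration, over the rev-3 vocabulary). -/
theorem vanishing_of_precompactUnguarded (hU : PrecompactFamiliesUnguarded) : VanishingFamilies := by
  intro D Λ hΩ hδ hadm K hK hKD ε hε
  obtain ⟨-, hii⟩ := hU D Λ hΩ hδ hadm K hK hKD
  obtain ⟨η, hη, hev⟩ := hii ε hε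
  filter_upwards [hev] with δ h z hz hzK
  obtain ⟨a, i, rfl⟩ := exists_eq_mk_add_single hz
  have hzK' : medialPoint δ (twin a i) ∈ K := by rwa [medialPoint_twin]
  have h0 : obs (Λ δ) δ (twin a i) = 0 := obs_eq_zero_of_not_mem_edgeSet (Λ δ) δ (twin_not_mem_edgeSet a i)
  have := h s(a, a + Pi.single i 1) (twin a i) hzK hzK' (by rw [medialPoint_twin, dist_self]; exact hη)
  change ‖obs (Λ δ) δ s(a, a + Pi.single i 1) - obs (Λ δ) δ (twin a i)‖ ≤ _ at this
  rwa [h0, sub_zero] at this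

/-- Conversely the zero world gives the unguarded B. -/
theorem precompactUnguarded_of_vanishing (hV : VanishingFamilies) : PrecompactFamiliesUnguarded := by
  intro D Λ hΩ hδ hadm F K hK hKD
  have hF : ∀ δ z, z ∉ (zdGraph 2).edgeSet → F δ z = 0 := fun δ z hz =>
    obs_eq_zero_of_not_mem_edgeSet (Λ δ) δ hz
  have bound : ∀ {ε : ℝ}, 0 < ε → ∀ᶠ δ in 𝓝[>] (0:ℝ), ∀ z : MedialVertex, medialPoint δ z ∈ K →
      ‖F δ z‖ ≤ ε * δ ^ ((1:ℝ) / 3) := by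
    intro ε hε
    filter_upwards [hV D Λ hΩ hδ hadm K hK hKD ε hε, self_mem_nhdsWithin] with δ h (hδ0 : 0 < δ) z hzK
    by_cases hz : z ∈ (zdGraph 2).edgeSet
    · exact h z hz hzK
    · rw [hF δ z hz, norm_zero]; exact mul_nonneg hε.le (Real.rpow_nonneg hδ0.le _)
  refine ⟨⟨1, bound one_pos⟩, fun ε hε => ⟨1, one_pos, ?_⟩⟩
  filter_upwards [bound (half_pos hε)] with δ h z z' hzK hz'K _
  calc ‖F δ z - F δ z'‖ ≤ ‖F δ z‖ + ‖F δ z'‖ := norm_sub_le _ _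
    _ ≤ ε / 2 * δ ^ ((1:ℝ) / 3) + ε / 2 * δ ^ ((1:ℝ) / 3) := add_le_add (h z hzK) (h z' hz'K)
    _ = ε * δ ^ ((1:ℝ) / 3) := by ring

/-- UNGUARDED B ⟺ ZERO WORLD. -/
theorem precompactUnguarded_iff_vanishing : PrecompactFamiliesUnguarded ↔ VanishingFamilies :=
  ⟨vanishing_of_precompactUnguarded, precompactUnguarded_of_vanishing⟩

/-- The unguarded (rev-2) crux is exactly `VanishingFamilies → C`: its hypotheses held ONLY in the
zero world. The rev-3 guard removes the forcing (`vanishing_of_precompactUnguarded`) but not the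
admissibility of the zero world (`precompactFamilies_of_vanishing`, `weakHolFamilies_of_vanishing`). -/
theorem cruxUnguarded_iff :
    (WeakHolFamilies → PrecompactFamiliesUnguarded → SLESixAllFamilies) ↔
      (VanishingFamilies → Literature.Probability.Percolation.SLE6LimitZ2AllDiscretisations) := by
  constructor
  · intro h hV
    exact slesixAllFamilies_iff_conjecture.1
      (h (weakHolFamilies_of_vanishing hV) (precompactUnguarded_of_vanishing hV))
  · intro h _ hU
    exact slesixAllFamilies_iff_conjecture.2 (h (vanishing_of_precompactUnguarded hU))


/-! ## §4 The missing input, dually: non-degeneracy is exactly what breaks the one-sidedness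

DCS 2012 Conj. 8.7 (arXiv:1109.1549, p. 36: `(2δ)^{-σ} F_δ(z) → φ'(z)^σ`, `φ` a conformal map onto the
strip `ℝ × (0,1)`, `a ↦ -∞`, `b ↦ +∞`; `φ' ≠ 0`) predicts the NEGATION of the zero world. The weakest
form of that prediction which already breaks `VanishingFamilies` is a `δ^{1/3}` LOWER bound at one
bulk edge along a sequence of meshes, for one admissible family of one domain (`NonDegenerate`).
Nothing in the tree proves it (on `ℤ²` even the untwisted two-arm exponent is open); it is the
normalisation input N the crux's intended proof needs and does not state. -/

/-- NON-DEGENERACY (the input N in its weakest useful form): for some Dobrushin domain, some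
discretisation family (same guards as the crux), some compact `K ⊆ D` and some `c > 0`, frequently as
`δ → 0⁺` some lattice edge under `K` carries `‖F_δ‖ ≥ c δ^{1/3}`. -/
def NonDegenerate : Prop :=
  ∃ (D : DobrushinDomain) (Λ : ℝ → DiscreteDobrushin), (∀ δ, (Λ δ).Ω = D.carrier) ∧
    (∀ δ, (Λ δ).δ = δ) ∧ (∀ᶠ δ in 𝓝[>] (0:ℝ), (Λ δ).IsZdAdmissible) ∧
    ∃ K : Set ℂ, IsCompact K ∧ K ⊆ D.carrier ∧ ∃ c > (0:ℝ), ∃ᶠ δ in 𝓝[>] (0:ℝ),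
      ∃ z : MedialVertex, z ∈ (zdGraph 2).edgeSet ∧ medialPoint δ z ∈ K ∧
        c * δ ^ ((1:ℝ) / 3) ≤ ‖obs (Λ δ) δ z‖

/-- Non-degeneracy refutes the zero world. -/
theorem not_vanishing_of_nonDegenerate (hN : NonDegenerate) : ¬ VanishingFamilies := by
  intro hV
  obtain ⟨D, Λ, hΩ, hδ, hadm, K, hK, hKD, c, hc, hfreq⟩ := hN
  have hev := hV D Λ hΩ hδ hadm K hK hKD (c / 2) (half_pos hc)
  refine hfreq ?_
  filter_upwards [hev, self_mem_nhdsWithin] with δ h (hδ0 : 0 < δ)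
  rintro ⟨z, hz, hzK, hle⟩
  have hpos : 0 < δ ^ ((1:ℝ) / 3) := Real.rpow_pos_of_pos hδ0 _
  have := hle.trans (h z hz hzK)
  nlinarith

/-- Conversely the zero world fails only through non-degeneracy (the two are each other's negation,
classically). -/
theorem nonDegenerate_of_not_vanishing (hV : ¬ VanishingFamilies) : NonDegenerate := by
  simp only [VanishingFamilies, not_forall] at hV
  obtain ⟨D, Λ, hΩ, hδ, hadm, K, hK, hKD, ε, hε, hnot⟩ := hV
  refine ⟨D, Λ, hΩ, hδ, hadm, K, hK, hKD, ε, hε, ?_⟩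
  rw [Filter.not_eventually] at hnot
  refine hnot.mono fun δ hδ' => ?_
  simp only [not_forall, not_le] at hδ'
  obtain ⟨z, hz, hzK, hlt⟩ := hδ'
  exact ⟨z, hz, hzK, hlt.le⟩

/-- Hence: WITHOUT non-degeneracy the crux is the bare conjecture. Any proof of the crux that is not a
proof of `SLE6LimitZ2AllDiscretisations` outright must establish `NonDegenerate` on the way. -/
theorem crux_iff_conjecture_of_not_nonDegenerate (hN : ¬ NonDegenerate) :
    ParafermionToSLESixFamilies ↔ Literature.Probability.Percolation.SLE6LimitZ2AllDiscretisations :=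
  crux_iff_conjecture_of_vanishing (by_contra fun hV => hN (nonDegenerate_of_not_vanishing hV))


/-! ## §5 Holomorphic worlds: the hypotheses cannot identify the limit

Generalising §1: for EVERY assignment `g D Λ : ℂ → ℂ` of a function holomorphic on `D` to each
domain and family, the world "`δ^{-1/3} F_δ` is locally uniformly `o(1)`-close to `g D Λ` on the
lattice edges" implies BOTH hypotheses A and B (`hypotheses_of_holoWorld`). B is immediate; A is a
DISCRETE integration by parts on each of the two sublattices of medial points (translates of `δℤ²`):
`Σ_a g(p_a)(φ(p_a+δu) − φ(p_a)) = Σ_a (g(p_a−δu) − g(p_a)) φ(p_a)` (shift invariance of lattice sums),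
the discrete Cauchy–Riemann defect of a holomorphic `g` is `O(δ·ω_{g'}(δ))` and the Taylor defect of
`φ` is `O(δ·ω_{φ'}(δ))`, against `O(δ⁻²)` sites — no integral is ever formed. Consequently
`crux_iff_conjecture_of_holoWorld : HoloWorld g → (crux ↔ SLE6LimitZ2AllDiscretisations)` for every
`g`: the pair (A, B) carries no information about WHICH holomorphic profile `δ^{-1/3}F_δ` follows
(DCS Conj. 8.7 says `(2^{1/3}) φ'_{D,a,b}^{1/3}`; `g ≡ 1`, `g ≡ 0`, `g = anything` are all admitted),
so the identification (free-arc boundary values, DC 2012 Prop. 5) and its slit-domain uniformity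
are inputs the crux's proof must create from nothing — or it proves Conj. 8.8(q=1) outright. -/

/-! ### Lattice sums on the two sublattices of medial points -/

/-- Mesh points are additive. -/
theorem meshPoint_add (δ : ℝ) (x y : Site 2) :
    meshPoint δ (x + y) = meshPoint δ x + meshPoint δ y := by
  apply Complex.ext
  · simp only [meshPoint_re, Complex.add_re, Pi.add_apply]; push_cast; ring
  · simp only [meshPoint_im, Complex.add_im, Pi.add_apply]; push_cast; ring

/-- The unit steps of the lattice as complex numbers. -/
theorem meshPoint_single_zero (δ : ℝ) : meshPoint δ (Pi.single 0 1 : Site 2) = (δ : ℂ) := by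
  apply Complex.ext <;> simp [meshPoint_re, meshPoint_im]

theorem meshPoint_single_one (δ : ℝ) : meshPoint δ (Pi.single 1 1 : Site 2) = (δ : ℂ) * Complex.I := by
  apply Complex.ext <;> simp [meshPoint_re, meshPoint_im]

/-- The medial point of the edge at `a` in direction `i`, as a function of the site. -/
def sublatticePoint (δ : ℝ) (i : Fin 2) (a : Site 2) : ℂ := medialPoint δ (latEdge (a, i))

theorem sublatticePoint_eq (δ : ℝ) (i : Fin 2) (a : Site 2) :
    sublatticePoint δ i a = medialPoint δ s(a, a + Pi.single i 1) := rfl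

/-- Each sublattice of medial points is a translate of `δℤ²`. -/
theorem sublatticePoint_add (δ : ℝ) (i : Fin 2) (a v : Site 2) :
    sublatticePoint δ i (a + v) = sublatticePoint δ i a + meshPoint δ v := by
  simp only [sublatticePoint, latEdge, medialPoint_mk, show a + v + Pi.single i 1 = a + Pi.single i 1 + v by abel,
    meshPoint_add]
  ring

theorem sublatticePoint_sub (δ : ℝ) (i : Fin 2) (a v : Site 2) :
    sublatticePoint δ i (a - v) = sublatticePoint δ i a - meshPoint δ v := by
  rw [eq_sub_iff_add_eq, ← sublatticePoint_add, sub_add_cancel]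

/-- Norm bound for a sum over the box. -/
theorem norm_sum_box_le {N : ℕ} {h : Site 2 → ℂ} {c : ℝ} (hb : ∀ a ∈ box N, ‖h a‖ ≤ c) :
    ‖∑ a ∈ box N, h a‖ ≤ (2 * N + 1) ^ 2 * c := by
  refine (norm_sum_le _ _).trans ?_
  refine (Finset.sum_le_card_nsmul _ _ c hb).trans ?_
  rw [nsmul_eq_mul, card_box]
  push_cast
  exact le_rfl

/-- A function on sites that vanishes unless the sublattice point is in `closedBall 0 R` is
supported in the box `[-N, N]²`, `N = ⌈R/δ⌉₊ + 1`. -/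
theorem support_subset_box {δ R : ℝ} (hδ : 0 < δ) (i : Fin 2) {h : Site 2 → ℂ}
    (hR : ∀ a, h a ≠ 0 → ‖sublatticePoint δ i a‖ ≤ R) :
    Function.support h ⊆ (box (⌈R / δ⌉₊ + 1) : Set (Site 2)) :=
  fun a ha => mem_box_of_norm_medialPoint_le hδ (hR a ha)

/-- Shift invariance of lattice sums. -/
theorem finsum_shift (v : Site 2) (H : Site 2 → ℂ) : ∑ᶠ a, H (a + v) = ∑ᶠ a, H a := by
  simpa using (finsum_comp_equiv (Equiv.addRight v) (f := H))

/-- DISCRETE INTEGRATION BY PARTS on a sublattice: for `Φ` vanishing off `closedBall 0 R` and ANY `G`,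
`Σ_{a ∈ box} G(p_a) (Φ(p_{a+v}) − Φ(p_a)) = Σ_{a ∈ box} (G(p_{a−v}) − G(p_a)) Φ(p_a)`, the box being
large enough to contain every site whose point or `v`-translate carries `Φ ≠ 0` (`‖meshPoint δ v‖ ≤ 1`). -/
theorem sum_box_mul_sub_eq {δ R : ℝ} (hδ : 0 < δ) (i : Fin 2) {Φ G : ℂ → ℂ} (v : Site 2)
    (hv : ‖meshPoint δ v‖ ≤ 1) (hΦ : ∀ p, Φ p ≠ 0 → ‖p‖ ≤ R) :
    ∑ a ∈ box (⌈(R + 1) / δ⌉₊ + 1), G (sublatticePoint δ i a) *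
        (Φ (sublatticePoint δ i (a + v)) - Φ (sublatticePoint δ i a)) =
      ∑ a ∈ box (⌈(R + 1) / δ⌉₊ + 1), (G (sublatticePoint δ i (a - v)) - G (sublatticePoint δ i a)) *
        Φ (sublatticePoint δ i a) := by
  set N := ⌈(R + 1) / δ⌉₊ + 1 with hN
  -- supports
  have hs1 : Function.support (fun a => G (sublatticePoint δ i a) * Φ (sublatticePoint δ i (a + v))) ⊆
      (box N : Set (Site 2)) := by
    refine support_subset_box hδ i fun a ha => ?_
    have hΦ' : Φ (sublatticePoint δ i (a + v)) ≠ 0 := fun h0 => ha (by rw [h0, mul_zero])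
    have h1 := hΦ _ hΦ'
    rw [sublatticePoint_add] at h1
    calc ‖sublatticePoint δ i a‖ = ‖(sublatticePoint δ i a + meshPoint δ v) - meshPoint δ v‖ := by
          rw [add_sub_cancel_right]
      _ ≤ ‖sublatticePoint δ i a + meshPoint δ v‖ + ‖meshPoint δ v‖ := norm_sub_le _ _
      _ ≤ R + 1 := add_le_add h1 hv
  have hs2 : Function.support (fun a => G (sublatticePoint δ i (a - v)) * Φ (sublatticePoint δ i a)) ⊆
      (box N : Set (Site 2)) := by
    refine support_subset_box hδ i fun a ha => ?_
    have hΦ' : Φ (sublatticePoint δ i a) ≠ 0 := fun h0 => ha (by rw [h0, mul_zero])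
    exact (hΦ _ hΦ').trans (by linarith)
  have hs3 : Function.support (fun a => G (sublatticePoint δ i a) * Φ (sublatticePoint δ i a)) ⊆
      (box N : Set (Site 2)) := by
    refine support_subset_box hδ i fun a ha => ?_
    have hΦ' : Φ (sublatticePoint δ i a) ≠ 0 := fun h0 => ha (by rw [h0, mul_zero])
    exact (hΦ _ hΦ').trans (by linarith)
  -- the shifted sum
  have key : ∑ a ∈ box N, G (sublatticePoint δ i a) * Φ (sublatticePoint δ i (a + v)) =
      ∑ a ∈ box N, G (sublatticePoint δ i (a - v)) * Φ (sublatticePoint δ i a) := by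
    rw [← finsum_eq_finsetSum_of_support_subset _ hs1, ← finsum_eq_finsetSum_of_support_subset _ hs2]
    rw [← finsum_shift v (fun a => G (sublatticePoint δ i (a - v)) * Φ (sublatticePoint δ i a))]
    simp only [add_sub_cancel_right]
  simp only [mul_sub, sub_mul, Finset.sum_sub_distrib, key]

/-! ### Two calculus facts -/

/-- Mean-value form of the first-order Taylor estimate along a segment. -/
theorem norm_sub_sub_le_of_hasFDerivAt {Φ : ℂ → ℂ} {Φ' : ℂ → ℂ →L[ℝ] ℂ} {p u : ℂ} {C : ℝ}
    (hd : ∀ x ∈ segment ℝ p (p + u), HasFDerivAt Φ (Φ' x) x)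
    (hb : ∀ x ∈ segment ℝ p (p + u), ‖Φ' x - Φ' p‖ ≤ C) :
    ‖Φ (p + u) - Φ p - Φ' p u‖ ≤ C * ‖u‖ := by
  have := Convex.norm_image_sub_le_of_norm_hasFDerivWithin_le'
    (fun x hx => (hd x hx).hasFDerivWithinAt) hb (convex_segment p (p + u))
    (left_mem_segment ℝ p (p + u)) (right_mem_segment ℝ p (p + u))
  simpa using this

/-- Points of the segment `[p, p + u]` are within `‖u‖` of `p`. -/
theorem dist_le_of_mem_segment {p u x : ℂ} (hx : x ∈ segment ℝ p (p + u)) : dist x p ≤ ‖u‖ := by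
  have hsub : segment ℝ p (p + u) ⊆ Metric.closedBall p ‖u‖ :=
    (convex_closedBall p ‖u‖).segment_subset (Metric.mem_closedBall_self (norm_nonneg u))
      (by simp [Metric.mem_closedBall, dist_eq_norm])
  exact Metric.mem_closedBall.1 (hsub hx)

/-- The Cauchy–Riemann identity `L 1 + i·L i = 0` of a `ℂ`-linear map (here `fderiv ℂ G p`, which is
`ℂ`-linear by type), in the form used by the weight `∂φ/∂x + i ∂φ/∂y` of hypothesis A. -/
theorem cr_identity (G : ℂ → ℂ) (p : ℂ) :
    (fderiv ℂ G p).restrictScalars ℝ 1 + Complex.I * (fderiv ℂ G p).restrictScalars ℝ Complex.I = 0 := by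
  set L : ℂ →L[ℂ] ℂ := fderiv ℂ G p
  have hI : L Complex.I = Complex.I * L 1 := by
    have := L.map_smul Complex.I 1
    simpa [smul_eq_mul] using this
  simp only [ContinuousLinearMap.coe_restrictScalars', hI]
  ring_nf
  rw [Complex.I_sq]
  ring

/-! ### The holomorphic world -/

/-- THE HOLOMORPHIC WORLD of a profile `g`: each `g D Λ` is holomorphic on `D` and `δ^{-1/3}F_δ` is
locally uniformly `o(1)`-close to it on the lattice edges (same guards as the crux).
`VanishingFamilies` is the case `g = 0` (`vanishing_iff_holoWorld_zero`). -/
def HoloWorld (g : DobrushinDomain → (ℝ → DiscreteDobrushin) → ℂ → ℂ) : Prop :=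
  (∀ D Λ, DifferentiableOn ℂ (g D Λ) D.carrier) ∧
  ∀ (D : DobrushinDomain) (Λ : ℝ → DiscreteDobrushin), (∀ δ, (Λ δ).Ω = D.carrier) →
    (∀ δ, (Λ δ).δ = δ) → (∀ᶠ δ in 𝓝[>] (0:ℝ), (Λ δ).IsZdAdmissible) →
    ∀ K : Set ℂ, IsCompact K → K ⊆ D.carrier → ∀ ε > (0:ℝ), ∀ᶠ δ in 𝓝[>] (0:ℝ),
      ∀ z : MedialVertex, z ∈ (zdGraph 2).edgeSet → medialPoint δ z ∈ K →
        ‖obs (Λ δ) δ z - ((δ ^ ((1:ℝ) / 3) : ℝ) : ℂ) * g D Λ (medialPoint δ z)‖ ≤ ε * δ ^ ((1:ℝ) / 3)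

/-- The zero world is the holomorphic world of the zero profile. -/
theorem vanishing_iff_holoWorld_zero : VanishingFamilies ↔ HoloWorld (fun _ _ _ => 0) := by
  constructor
  · intro hV
    refine ⟨fun _ _ => differentiableOn_const 0, ?_⟩
    intro D Λ hΩ hδ hadm K hK hKD ε hε
    filter_upwards [hV D Λ hΩ hδ hadm K hK hKD ε hε] with δ h z hz hzK
    simpa using h z hz hzK
  · rintro ⟨-, hW⟩ D Λ hΩ hδ hadm K hK hKD ε hε
    filter_upwards [hW D Λ hΩ hδ hadm K hK hKD ε hε] with δ h z hz hzK
    simpa using h z hz hzK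

/-- In every holomorphic world hypothesis B (precompactness) holds: bound `sup_K |g| + 1`, modulus
from the uniform continuity of `g` on `K`. -/
theorem precompactFamilies_of_holoWorld {g : DobrushinDomain → (ℝ → DiscreteDobrushin) → ℂ → ℂ}
    (hW : HoloWorld g) : PrecompactFamilies := by
  obtain ⟨hg, hW⟩ := hW
  intro D Λ hΩ hδ hadm F K hK hKD
  have hcont : ContinuousOn (g D Λ) K := ((hg D Λ).continuousOn).mono hKD
  obtain ⟨M₀, hM₀⟩ := hK.exists_bound_of_continuousOn hcont
  set M : ℝ := max M₀ 0 with hMdef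
  have hM : ∀ x ∈ K, ‖g D Λ x‖ ≤ M := fun x hx => (hM₀ x hx).trans (le_max_left _ _)
  have hnorm : ∀ δ : ℝ, 0 < δ → ‖((δ ^ ((1:ℝ) / 3) : ℝ) : ℂ)‖ = δ ^ ((1:ℝ) / 3) := fun δ hδ0 => by
    rw [Complex.norm_real, Real.norm_eq_abs, abs_of_nonneg (Real.rpow_nonneg hδ0.le _)]
  refine ⟨⟨M + 1, ?_⟩, ?_⟩
  · filter_upwards [hW D Λ hΩ hδ hadm K hK hKD 1 one_pos, self_mem_nhdsWithin] with δ h (hδ0 : 0 < δ) z hz hzK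
    have h1 := h z hz hzK
    calc ‖F δ z‖ = ‖(F δ z - ((δ ^ ((1:ℝ) / 3) : ℝ) : ℂ) * g D Λ (medialPoint δ z)) +
          ((δ ^ ((1:ℝ) / 3) : ℝ) : ℂ) * g D Λ (medialPoint δ z)‖ := by rw [sub_add_cancel]
      _ ≤ 1 * δ ^ ((1:ℝ) / 3) + δ ^ ((1:ℝ) / 3) * M := by
          refine (norm_add_le _ _).trans (add_le_add h1 ?_)
          rw [norm_mul, hnorm δ hδ0]
          exact mul_le_mul_of_nonneg_left (hM _ hzK) (Real.rpow_nonneg hδ0.le _)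
      _ = (M + 1) * δ ^ ((1:ℝ) / 3) := by ring
  · intro ε hε
    have huc : UniformContinuousOn (g D Λ) K := hK.uniformContinuousOn_of_continuous hcont
    obtain ⟨η, hη, hηuc⟩ := Metric.uniformContinuousOn_iff.1 huc (ε / 3) (by positivity)
    refine ⟨η, hη, ?_⟩
    filter_upwards [hW D Λ hΩ hδ hadm K hK hKD (ε / 3) (by positivity), self_mem_nhdsWithin] with δ h
      (hδ0 : 0 < δ) z z' hz hz' hzK hz'K hdist
    have h1 := h z hz hzK
    have h2 := h z' hz' hz'K
    have h3 : ‖g D Λ (medialPoint δ z) - g D Λ (medialPoint δ z')‖ ≤ ε / 3 := by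
      rw [← dist_eq_norm]; exact (hηuc _ hzK _ hz'K hdist).le
    set c : ℂ := ((δ ^ ((1:ℝ) / 3) : ℝ) : ℂ) with hc
    have hsplit : F δ z - F δ z' = (F δ z - c * g D Λ (medialPoint δ z)) +
          c * (g D Λ (medialPoint δ z) - g D Λ (medialPoint δ z')) -
          (F δ z' - c * g D Λ (medialPoint δ z')) := by ring
    calc ‖F δ z - F δ z'‖
        ≤ ‖F δ z - c * g D Λ (medialPoint δ z)‖ + ‖c * (g D Λ (medialPoint δ z) - g D Λ (medialPoint δ z'))‖ +
          ‖F δ z' - c * g D Λ (medialPoint δ z')‖ := by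
          rw [hsplit]
          exact (norm_sub_le _ _).trans (add_le_add (norm_add_le _ _) le_rfl)
      _ ≤ ε / 3 * δ ^ ((1:ℝ) / 3) + δ ^ ((1:ℝ) / 3) * (ε / 3) + ε / 3 * δ ^ ((1:ℝ) / 3) := by
          refine add_le_add (add_le_add h1 ?_) h2
          rw [norm_mul, hc, hnorm δ hδ0]
          exact mul_le_mul_of_nonneg_left h3 (Real.rpow_nonneg hδ0.le _)
      _ = ε * δ ^ ((1:ℝ) / 3) := by ring


/-- In every holomorphic world hypothesis A (weak holomorphy) holds. Discrete integration by parts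
on each sublattice, the Cauchy–Riemann identity of `g`, first-order Taylor defects controlled by the
moduli of uniform continuity of `fderiv ℝ φ` (compact support) and of `fderiv ℂ g` (on a compact
thickening of `tsupport φ` inside `D`), against `O(δ⁻²)` sites. -/
theorem weakHolFamilies_of_holoWorld {g : DobrushinDomain → (ℝ → DiscreteDobrushin) → ℂ → ℂ}
    (hW : HoloWorld g) : WeakHolFamilies := by
  obtain ⟨hg, hW⟩ := hW
  intro D Λ hΩ hδ hadm φ hφ hφc hφD
  set G : ℂ → ℂ := g D Λ with hGdef
  have hGd : DifferentiableOn ℂ G D.carrier := hg D Λ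
  have hDo : IsOpen D.carrier := D.isOpen
  -- compacts: K = tsupport φ ⊆ K₁ = cthickening r₁ K ⊆ D
  have hK : IsCompact (tsupport φ) := hφc
  obtain ⟨r₀, hr₀, hr₀D⟩ := hK.exists_cthickening_subset_open hDo hφD
  set r₁ : ℝ := min r₀ 1 with hr₁
  have hr₁0 : 0 < r₁ := lt_min hr₀ one_pos
  have hr₁1 : r₁ ≤ 1 := min_le_right _ _
  set K₁ : Set ℂ := Metric.cthickening r₁ (tsupport φ) with hK₁
  have hK₁c : IsCompact K₁ := hK.cthickening
  have hK₁D : K₁ ⊆ D.carrier := (Metric.cthickening_mono (min_le_left _ _) _).trans hr₀D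
  have hKK₁ : tsupport φ ⊆ K₁ := Metric.self_subset_cthickening _
  -- a ball containing the support
  obtain ⟨R₀, hR₀⟩ := hK.isBounded.subset_closedBall (0 : ℂ)
  set R : ℝ := max R₀ 0 with hRdef
  have hR : tsupport φ ⊆ Metric.closedBall (0:ℂ) R :=
    hR₀.trans (Metric.closedBall_subset_closedBall (le_max_left _ _))
  have hR0 : 0 ≤ R := le_max_right _ _
  have hRφ : ∀ p, φ p ≠ 0 → ‖p‖ ≤ R := fun p hp => by
    have := hR (subset_tsupport _ (Function.mem_support.2 hp))
    rwa [Metric.mem_closedBall, dist_zero_right] at this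
  -- bounds: ‖fderiv φ‖ ≤ M, ‖φ‖ ≤ Mφ, ‖G‖ ≤ MG on K₁
  obtain ⟨M, hM⟩ : ∃ M, ∀ x, ‖fderiv ℝ φ x‖ ≤ M :=
    (hφ.continuous_fderiv (by simp)).bounded_above_of_compact_support (hφc.fderiv (𝕜 := ℝ))
  have hM0 : 0 ≤ M := (norm_nonneg _).trans (hM 0)
  obtain ⟨Mφ, hMφ⟩ : ∃ M, ∀ x, ‖φ x‖ ≤ M := hφ.continuous.bounded_above_of_compact_support hφc
  have hMφ0 : 0 ≤ Mφ := (norm_nonneg _).trans (hMφ 0)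
  have hGcont : ContinuousOn G D.carrier := hGd.continuousOn
  obtain ⟨MG₀, hMG₀⟩ := hK₁c.exists_bound_of_continuousOn (hGcont.mono hK₁D)
  set MG : ℝ := max MG₀ 0 with hMGdef
  have hMG : ∀ x ∈ K₁, ‖G x‖ ≤ MG := fun x hx => (hMG₀ x hx).trans (le_max_left _ _)
  have hMG0 : 0 ≤ MG := le_max_right _ _
  -- derivatives
  have hφd : ∀ x, HasFDerivAt φ (fderiv ℝ φ x) x := fun x =>
    ((hφ.differentiable (by simp)) x).hasFDerivAt
  set G' : ℂ → ℂ →L[ℝ] ℂ := fun x => (fderiv ℂ G x).restrictScalars ℝ with hG'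
  have hGd' : ∀ x ∈ D.carrier, HasFDerivAt G (G' x) x := fun x hx =>
    ((hGd x hx).differentiableAt (hDo.mem_nhds hx)).hasFDerivAt.restrictScalars ℝ
  have hG'lin : ∀ x (v : ℂ), G' x v = v * (fderiv ℂ G x) 1 := by
    intro x v
    have := (fderiv ℂ G x).map_smul v 1
    simp only [smul_eq_mul, mul_one] at this
    simp [hG', this]
  -- uniform continuity moduli
  have hucφ : UniformContinuous (fderiv ℝ φ) :=
    (hφc.fderiv (𝕜 := ℝ)).uniformContinuous_of_continuous (hφ.continuous_fderiv (by simp))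
  have hGc1 : ContinuousOn (fderiv ℂ G) D.carrier :=
    (hGd.contDiffOn (n := 1) hDo).continuousOn_fderiv_of_isOpen hDo le_rfl
  have hucG : UniformContinuousOn (fderiv ℂ G) K₁ := hK₁c.uniformContinuousOn_of_continuous (hGc1.mono hK₁D)
  -- the weight and its support
  set Wφ : ℂ → ℂ := fun p => fderiv ℝ φ p 1 + Complex.I * fderiv ℝ φ p Complex.I with hWφ
  have hWφ_norm : ∀ p, ‖Wφ p‖ ≤ 2 * M := by
    intro p
    have h1 : ‖fderiv ℝ φ p 1‖ ≤ M := by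
      refine (ContinuousLinearMap.le_opNorm _ _).trans ?_; simpa using hM p
    have h2 : ‖Complex.I * fderiv ℝ φ p Complex.I‖ ≤ M := by
      rw [norm_mul, Complex.norm_I, one_mul]
      refine (ContinuousLinearMap.le_opNorm _ _).trans ?_; simpa using hM p
    calc ‖Wφ p‖ ≤ ‖fderiv ℝ φ p 1‖ + ‖Complex.I * fderiv ℝ φ p Complex.I‖ := norm_add_le _ _
      _ ≤ M + M := add_le_add h1 h2
      _ = 2 * M := by ring
  have hWφ_supp : ∀ p, Wφ p ≠ 0 → p ∈ tsupport φ := by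
    intro p hp
    by_contra hnot
    apply hp
    have h0 : fderiv ℝ φ p = 0 := fderiv_of_notMem_tsupport ℝ hnot
    simp [hWφ, h0]
  -- ε-management
  rw [Metric.tendsto_nhds]
  intro ε₀ hε₀
  set C₀ : ℝ := (2 * (R + 1) + 5) ^ 2 with hC₀
  have hC₀0 : 0 < C₀ := by positivity
  set ε : ℝ := ε₀ / (8 * C₀ * (M + 1)) with hεdef
  have hε : 0 < ε := by positivity
  set cG : ℝ := ε₀ / (16 * C₀ * (Mφ + 1)) with hcGdef
  have hcG : 0 < cG := by positivity
  set cΦ : ℝ := ε₀ / (16 * C₀ * (MG + 1)) with hcΦdef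
  have hcΦ : 0 < cΦ := by positivity
  clear_value ε cG cΦ C₀
  obtain ⟨ηΦ, hηΦ, hηΦuc⟩ := Metric.uniformContinuous_iff.1 hucφ cΦ hcΦ
  obtain ⟨ηG, hηG, hηGuc⟩ := Metric.uniformContinuousOn_iff.1 hucG cG hcG
  set δ₁ : ℝ := min (min r₁ (ηΦ / 2)) (ηG / 2) with hδ₁
  have hδ₁0 : 0 < δ₁ := by positivity
  filter_upwards [hW D Λ hΩ hδ hadm (tsupport φ) hK hφD ε hε, Ioo_mem_nhdsGT hδ₁0] with δ hWδ hδI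
  obtain ⟨hδ0, hδlt⟩ := hδI
  have hδr₁ : δ ≤ r₁ := hδlt.le.trans ((min_le_left _ _).trans (min_le_left _ _))
  have hδ1 : δ ≤ 1 := hδr₁.trans hr₁1
  have hδηΦ : δ < ηΦ := by
    have : δ₁ ≤ ηΦ / 2 := (min_le_left _ _).trans (min_le_right _ _)
    linarith
  have hδηG : δ < ηG := by
    have : δ₁ ≤ ηG / 2 := min_le_right _ _
    linarith
  rw [dist_zero_right]
  -- the box
  set N : ℕ := ⌈(R + 1) / δ⌉₊ + 1 with hN
  have hboxR : ((2 * (N:ℝ) + 1) ^ 2) * δ ^ 2 ≤ C₀ := by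
    have hceil : (⌈(R + 1) / δ⌉₊ : ℝ) < (R + 1) / δ + 1 := Nat.ceil_lt_add_one (by positivity)
    have hN' : (N : ℝ) < (R + 1) / δ + 2 := by rw [hN]; push_cast; linarith
    have h' : δ * (N:ℝ) ≤ (R + 1) + 2 * δ := by
      have := mul_le_mul_of_nonneg_left hN'.le hδ0.le
      rw [mul_add, mul_div_cancel₀ _ hδ0.ne'] at this
      linarith
    have h1 : δ * (2 * (N:ℝ) + 1) ≤ 2 * (R + 1) + 5 := by nlinarith
    have h2 : 0 ≤ δ * (2 * (N:ℝ) + 1) := by positivity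
    calc ((2 * (N:ℝ) + 1) ^ 2) * δ ^ 2 = (δ * (2 * (N:ℝ) + 1)) ^ 2 := by ring
      _ ≤ (2 * (R + 1) + 5) ^ 2 := pow_le_pow_left₀ h2 h1 2
      _ = C₀ := hC₀.symm
  -- abbreviations at this mesh
  set c3 : ℂ := ((δ ^ ((1:ℝ) / 3) : ℝ) : ℂ) with hc3
  have hc3n : ‖c3‖ = δ ^ ((1:ℝ) / 3) := by
    rw [hc3, Complex.norm_real, Real.norm_eq_abs, abs_of_nonneg (Real.rpow_nonneg hδ0.le _)]
  set P : Fin 2 → Site 2 → ℂ := fun i a => sublatticePoint δ i a with hP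
  -- (1) reduce the finsum to the box
  have hsupp : Function.support (fun z => obs (Λ δ) δ z *
      ((fderiv ℝ φ (medialPoint δ z) 1 + Complex.I * fderiv ℝ φ (medialPoint δ z) Complex.I) / 2)) ⊆
      ((edgesInBox N : Finset MedialVertex) : Set MedialVertex) := by
    intro z hz
    rw [Function.mem_support, mul_ne_zero_iff] at hz
    obtain ⟨hobs, hwz⟩ := hz
    have hzE : z ∈ (zdGraph 2).edgeSet := by
      by_contra h; exact hobs (obs_eq_zero_of_not_mem_edgeSet (Λ δ) δ h)
    obtain ⟨a, i, rfl⟩ := exists_eq_mk_add_single hzE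
    have hw' : Wφ (medialPoint δ s(a, a + Pi.single i 1)) ≠ 0 := by
      intro h0; apply hwz; change Wφ _ / 2 = 0; rw [h0, zero_div]
    have hin := hR (hWφ_supp _ hw')
    rw [Metric.mem_closedBall, dist_zero_right] at hin
    exact mem_edgesInBox hδ0 (hin.trans (by linarith))
  have hsum : (∑ᶠ z, obs (Λ δ) δ z *
      ((fderiv ℝ φ (medialPoint δ z) 1 + Complex.I * fderiv ℝ φ (medialPoint δ z) Complex.I) / 2)) =
      ∑ i : Fin 2, ∑ a ∈ box N, obs (Λ δ) δ (latEdge (a, i)) * (Wφ (P i a) / 2) := by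
    rw [finsum_eq_finsetSum_of_support_subset _ hsupp, sum_edgesInBox, Finset.sum_product,
      Finset.sum_comm]
    rfl
  -- (2) per sublattice: error part
  have herr : ∀ i : Fin 2, ‖∑ a ∈ box N, (obs (Λ δ) δ (latEdge (a, i)) - c3 * G (P i a)) * (Wφ (P i a) / 2)‖
      ≤ (2 * N + 1) ^ 2 * (ε * δ ^ ((1:ℝ) / 3) * M) := by
    intro i
    refine norm_sum_box_le fun a _ => ?_
    by_cases hw0 : Wφ (P i a) = 0
    · rw [hw0, zero_div, mul_zero, norm_zero]; positivity
    have hPK : P i a ∈ tsupport φ := hWφ_supp _ hw0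
    have h1 := hWδ (latEdge (a, i)) (latEdge_mem_edgeSet _) hPK
    rw [norm_mul]
    refine mul_le_mul h1 ?_ (norm_nonneg _) (by positivity)
    rw [norm_div, Complex.norm_ofNat]
    linarith [hWφ_norm (P i a)]
  -- (3) per sublattice: the main part `Mi = Σ G(P a) Wφ(P a)` is small
  have hmain : ∀ i : Fin 2, ‖∑ a ∈ box N, G (P i a) * Wφ (P i a)‖ ≤
      (2 * N + 1) ^ 2 * (2 * (cG * Mφ + MG * cΦ)) := by
    intro i
    -- Taylor defects of φ
    have hρ : ∀ a, ‖(φ (P i a + δ) - φ (P i a)) + Complex.I * (φ (P i a + δ * Complex.I) - φ (P i a)) -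
        (δ : ℂ) * Wφ (P i a)‖ ≤ 2 * (cΦ * δ) := by
      intro a
      set p := P i a
      have e1 : (δ : ℂ) * Wφ p = fderiv ℝ φ p (δ : ℂ) + Complex.I * fderiv ℝ φ p ((δ : ℂ) * Complex.I) := by
        have m1 : fderiv ℝ φ p ((δ:ℝ) • (1:ℂ)) = (δ:ℝ) • fderiv ℝ φ p 1 := (fderiv ℝ φ p).map_smul δ 1
        have m2 : fderiv ℝ φ p ((δ:ℝ) • Complex.I) = (δ:ℝ) • fderiv ℝ φ p Complex.I :=
          (fderiv ℝ φ p).map_smul δ Complex.I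
        simp only [Complex.real_smul, mul_one] at m1 m2
        rw [m1, m2, hWφ]; ring
      have t1 : ‖φ (p + δ) - φ p - fderiv ℝ φ p (δ:ℂ)‖ ≤ cΦ * ‖(δ:ℂ)‖ := by
        refine norm_sub_sub_le_of_hasFDerivAt (fun x _ => hφd x) fun x hx => ?_
        have hd : dist x p < ηΦ := (dist_le_of_mem_segment hx).trans_lt (by simpa [abs_of_pos hδ0] using hδηΦ)
        rw [← dist_eq_norm]; exact (hηΦuc hd).le
      have t2 : ‖φ (p + δ * Complex.I) - φ p - fderiv ℝ φ p ((δ:ℂ) * Complex.I)‖ ≤ cΦ * ‖(δ:ℂ) * Complex.I‖ := by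
        refine norm_sub_sub_le_of_hasFDerivAt (fun x _ => hφd x) fun x hx => ?_
        have hd : dist x p < ηΦ := (dist_le_of_mem_segment hx).trans_lt (by simpa [abs_of_pos hδ0] using hδηΦ)
        rw [← dist_eq_norm]; exact (hηΦuc hd).le
      have nδ : ‖(δ:ℂ)‖ = δ := by simp [abs_of_pos hδ0]
      have nδI : ‖(δ:ℂ) * Complex.I‖ = δ := by simp [abs_of_pos hδ0]
      rw [nδ] at t1; rw [nδI] at t2
      calc _ = ‖(φ (p + δ) - φ p - fderiv ℝ φ p (δ:ℂ)) +
            Complex.I * (φ (p + δ * Complex.I) - φ p - fderiv ℝ φ p ((δ:ℂ) * Complex.I))‖ := by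
            rw [e1]; ring_nf
        _ ≤ ‖φ (p + δ) - φ p - fderiv ℝ φ p (δ:ℂ)‖ +
            ‖Complex.I * (φ (p + δ * Complex.I) - φ p - fderiv ℝ φ p ((δ:ℂ) * Complex.I))‖ := norm_add_le _ _
        _ ≤ cΦ * δ + cΦ * δ := by
            refine add_le_add t1 ?_
            rw [norm_mul, Complex.norm_I, one_mul]; exact t2
        _ = 2 * (cΦ * δ) := by ring
    -- where the defect is non-zero, the point is in K₁
    have hρK : ∀ a, (φ (P i a + δ) - φ (P i a)) + Complex.I * (φ (P i a + δ * Complex.I) - φ (P i a)) -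
        (δ : ℂ) * Wφ (P i a) ≠ 0 → P i a ∈ K₁ := by
      intro a hne
      by_contra hnot
      apply hne
      have far : ∀ q, dist (P i a) q ≤ δ → q ∉ tsupport φ := by
        intro q hq hqK
        exact hnot (Metric.mem_cthickening_of_dist_le _ _ _ _ hqK (hq.trans hδr₁))
      have z0 : φ (P i a) = 0 := image_eq_zero_of_notMem_tsupport (far _ (by simp [hδ0.le]))
      have z1 : φ (P i a + δ) = 0 := image_eq_zero_of_notMem_tsupport (far _ (by simp [abs_of_pos hδ0]))
      have z2 : φ (P i a + δ * Complex.I) = 0 :=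
        image_eq_zero_of_notMem_tsupport (far _ (by simp [abs_of_pos hδ0]))
      have z3 : Wφ (P i a) = 0 := by
        by_contra h; exact far _ (by simp [hδ0.le]) (hWφ_supp _ h)
      simp [z0, z1, z2, z3]
    -- CR defects of G at points of the support
    have hκ : ∀ a, φ (P i a) ≠ 0 →
        ‖(G (P i a - δ) - G (P i a)) + Complex.I * (G (P i a - δ * Complex.I) - G (P i a))‖ ≤ 2 * (cG * δ) := by
      intro a ha
      set p := P i a
      have hpK : p ∈ tsupport φ := subset_tsupport _ (Function.mem_support.2 ha)
      have hpD : p ∈ D.carrier := hφD hpK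
      have seg : ∀ u : ℂ, ‖u‖ ≤ δ → ∀ x ∈ segment ℝ p (p + u), x ∈ K₁ ∧ dist x p < ηG := by
        intro u hu x hx
        have hd : dist x p ≤ δ := (dist_le_of_mem_segment hx).trans hu
        exact ⟨Metric.mem_cthickening_of_dist_le _ _ _ _ hpK (hd.trans hδr₁), hd.trans_lt hδηG⟩
      have hpK₁ : p ∈ K₁ := hKK₁ hpK
      have mvt : ∀ u : ℂ, ‖u‖ ≤ δ → ‖G (p + u) - G p - G' p u‖ ≤ cG * ‖u‖ := by
        intro u hu
        refine norm_sub_sub_le_of_hasFDerivAt (fun x hx => hGd' x (hK₁D (seg u hu x hx).1)) fun x hx => ?_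
        have h := (hηGuc x (seg u hu x hx).1 p hpK₁ (seg u hu x hx).2).le
        rw [dist_eq_norm] at h
        calc ‖G' x - G' p‖ = ‖(fderiv ℂ G x - fderiv ℂ G p).restrictScalars ℝ‖ := by
              simp only [hG', ContinuousLinearMap.restrictScalars_sub]
          _ = ‖fderiv ℂ G x - fderiv ℂ G p‖ := ContinuousLinearMap.norm_restrictScalars _
          _ ≤ cG := h
      have nδ : ‖(-(δ:ℂ))‖ = δ := by simp [abs_of_pos hδ0]
      have nδI : ‖(-((δ:ℂ) * Complex.I))‖ = δ := by simp [abs_of_pos hδ0]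
      have t1 := mvt (-(δ:ℂ)) nδ.le
      have t2 := mvt (-((δ:ℂ) * Complex.I)) nδI.le
      rw [nδ] at t1; rw [nδI] at t2
      have cr : G' p (-(δ:ℂ)) + Complex.I * G' p (-((δ:ℂ) * Complex.I)) = 0 := by
        rw [hG'lin, hG'lin]; ring_nf; rw [Complex.I_sq]; ring
      calc _ = ‖(G (p + -(δ:ℂ)) - G p - G' p (-(δ:ℂ))) +
            Complex.I * (G (p + -((δ:ℂ) * Complex.I)) - G p - G' p (-((δ:ℂ) * Complex.I))) +
            (G' p (-(δ:ℂ)) + Complex.I * G' p (-((δ:ℂ) * Complex.I)))‖ := by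
            congr 1; simp only [sub_eq_add_neg]; ring
        _ ≤ ‖G (p + -(δ:ℂ)) - G p - G' p (-(δ:ℂ))‖ +
            ‖Complex.I * (G (p + -((δ:ℂ) * Complex.I)) - G p - G' p (-((δ:ℂ) * Complex.I)))‖ + 0 := by
            rw [cr]; refine (norm_add_le _ _).trans (add_le_add (norm_add_le _ _) (by simp))
        _ ≤ cG * δ + cG * δ + 0 := by
            refine add_le_add (add_le_add t1 ?_) le_rfl
            rw [norm_mul, Complex.norm_I, one_mul]; exact t2
        _ = 2 * (cG * δ) := by ring
    -- discrete integration by parts, twice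
    have hv0 : ‖meshPoint δ (Pi.single 0 1 : Site 2)‖ ≤ 1 := by
      rw [meshPoint_single_zero]; simpa [abs_of_pos hδ0] using hδ1
    have hv1 : ‖meshPoint δ (Pi.single 1 1 : Site 2)‖ ≤ 1 := by
      rw [meshPoint_single_one]; simpa [abs_of_pos hδ0] using hδ1
    have ibp0 := sum_box_mul_sub_eq hδ0 i (Φ := φ) (G := G) (Pi.single 0 1) hv0 hRφ
    have ibp1 := sum_box_mul_sub_eq hδ0 i (Φ := φ) (G := G) (Pi.single 1 1) hv1 hRφ
    simp only [sublatticePoint_add, sublatticePoint_sub, meshPoint_single_zero, meshPoint_single_one] at ibp0 ibp1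
    -- δ · Mi = Σ κ φ − Σ G ρ
    have hdec : (δ:ℂ) * ∑ a ∈ box N, G (P i a) * Wφ (P i a) =
        ∑ a ∈ box N, ((G (P i a - δ) - G (P i a)) + Complex.I * (G (P i a - δ * Complex.I) - G (P i a))) * φ (P i a)
        - ∑ a ∈ box N, G (P i a) * ((φ (P i a + δ) - φ (P i a)) + Complex.I * (φ (P i a + δ * Complex.I) - φ (P i a)) -
            (δ : ℂ) * Wφ (P i a)) := by
      have e0 : ∑ a ∈ box N, G (P i a) * (φ (P i a + δ) - φ (P i a)) =
          ∑ a ∈ box N, (G (P i a - δ) - G (P i a)) * φ (P i a) := ibp0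
      have e1 : ∑ a ∈ box N, G (P i a) * (φ (P i a + δ * Complex.I) - φ (P i a)) =
          ∑ a ∈ box N, (G (P i a - δ * Complex.I) - G (P i a)) * φ (P i a) := ibp1
      have lhs : (δ:ℂ) * ∑ a ∈ box N, G (P i a) * Wφ (P i a) =
          ∑ a ∈ box N, G (P i a) * (φ (P i a + δ) - φ (P i a)) +
          Complex.I * ∑ a ∈ box N, G (P i a) * (φ (P i a + δ * Complex.I) - φ (P i a)) -
          ∑ a ∈ box N, G (P i a) * ((φ (P i a + δ) - φ (P i a)) + Complex.I * (φ (P i a + δ * Complex.I) - φ (P i a)) -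
            (δ : ℂ) * Wφ (P i a)) := by
        rw [Finset.mul_sum, Finset.mul_sum, ← Finset.sum_add_distrib, ← Finset.sum_sub_distrib]
        refine Finset.sum_congr rfl fun a _ => ?_
        ring
      rw [lhs, e0, e1, Finset.mul_sum, ← Finset.sum_add_distrib]
      congr 1
      refine Finset.sum_congr rfl fun a _ => ?_
      ring
    -- bounds of the two sums
    have b1 : ‖∑ a ∈ box N, ((G (P i a - δ) - G (P i a)) + Complex.I * (G (P i a - δ * Complex.I) - G (P i a))) * φ (P i a)‖
        ≤ (2 * N + 1) ^ 2 * (2 * (cG * δ) * Mφ) := by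
      refine norm_sum_box_le fun a _ => ?_
      by_cases ha : φ (P i a) = 0
      · rw [ha, mul_zero, norm_zero]; positivity
      rw [norm_mul]
      exact mul_le_mul (hκ a ha) (hMφ _) (norm_nonneg _) (by positivity)
    have b2 : ‖∑ a ∈ box N, G (P i a) * ((φ (P i a + δ) - φ (P i a)) + Complex.I * (φ (P i a + δ * Complex.I) - φ (P i a)) -
            (δ : ℂ) * Wφ (P i a))‖ ≤ (2 * N + 1) ^ 2 * (MG * (2 * (cΦ * δ))) := by
      refine norm_sum_box_le fun a _ => ?_
      by_cases hz : (φ (P i a + δ) - φ (P i a)) + Complex.I * (φ (P i a + δ * Complex.I) - φ (P i a)) -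
            (δ : ℂ) * Wφ (P i a) = 0
      · rw [hz, mul_zero, norm_zero]; positivity
      rw [norm_mul]
      exact mul_le_mul (hMG _ (hρK a hz)) (hρ a) (norm_nonneg _) hMG0
    have b3 : ‖(δ:ℂ) * ∑ a ∈ box N, G (P i a) * Wφ (P i a)‖ ≤
        (2 * N + 1) ^ 2 * (2 * (cG * δ) * Mφ) + (2 * N + 1) ^ 2 * (MG * (2 * (cΦ * δ))) := by
      rw [hdec]; exact (norm_sub_le _ _).trans (add_le_add b1 b2)
    rw [norm_mul, Complex.norm_real, Real.norm_eq_abs, abs_of_pos hδ0] at b3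
    have : δ * ‖∑ a ∈ box N, G (P i a) * Wφ (P i a)‖ ≤ δ * ((2 * N + 1) ^ 2 * (2 * (cG * Mφ + MG * cΦ))) := by
      refine b3.trans (le_of_eq ?_); ring
    exact le_of_mul_le_mul_left this hδ0
  -- (4) assemble
  have hS : ∀ i : Fin 2, ‖∑ a ∈ box N, obs (Λ δ) δ (latEdge (a, i)) * (Wφ (P i a) / 2)‖ ≤
      (2 * N + 1) ^ 2 * (ε * δ ^ ((1:ℝ) / 3) * M) + δ ^ ((1:ℝ) / 3) * ((2 * N + 1) ^ 2 * (cG * Mφ + MG * cΦ)) := by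
    intro i
    have split : ∑ a ∈ box N, obs (Λ δ) δ (latEdge (a, i)) * (Wφ (P i a) / 2) =
        ∑ a ∈ box N, (obs (Λ δ) δ (latEdge (a, i)) - c3 * G (P i a)) * (Wφ (P i a) / 2) +
        c3 / 2 * ∑ a ∈ box N, G (P i a) * Wφ (P i a) := by
      rw [Finset.mul_sum, ← Finset.sum_add_distrib]
      refine Finset.sum_congr rfl fun a _ => ?_; ring
    rw [split]
    refine (norm_add_le _ _).trans (add_le_add (herr i) ?_)
    rw [norm_mul, norm_div, hc3n, Complex.norm_ofNat]
    calc δ ^ ((1:ℝ) / 3) / 2 * ‖∑ a ∈ box N, G (P i a) * Wφ (P i a)‖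
        ≤ δ ^ ((1:ℝ) / 3) / 2 * ((2 * N + 1) ^ 2 * (2 * (cG * Mφ + MG * cΦ))) :=
          mul_le_mul_of_nonneg_left (hmain i) (by positivity)
      _ = δ ^ ((1:ℝ) / 3) * ((2 * N + 1) ^ 2 * (cG * Mφ + MG * cΦ)) := by ring
  have hpow : δ ^ ((5:ℝ) / 3) * δ ^ ((1:ℝ) / 3) = δ ^ 2 := by
    rw [← Real.rpow_add hδ0, show (5:ℝ) / 3 + 1 / 3 = 2 by norm_num, Real.rpow_two]
  have hfin : ∀ i : Fin 2, δ ^ ((5:ℝ) / 3) * ‖∑ a ∈ box N, obs (Λ δ) δ (latEdge (a, i)) * (Wφ (P i a) / 2)‖ ≤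
      C₀ * (ε * M) + C₀ * (cG * Mφ + MG * cΦ) := by
    intro i
    calc δ ^ ((5:ℝ) / 3) * ‖∑ a ∈ box N, obs (Λ δ) δ (latEdge (a, i)) * (Wφ (P i a) / 2)‖
        ≤ δ ^ ((5:ℝ) / 3) * ((2 * N + 1) ^ 2 * (ε * δ ^ ((1:ℝ) / 3) * M) +
            δ ^ ((1:ℝ) / 3) * ((2 * N + 1) ^ 2 * (cG * Mφ + MG * cΦ))) :=
          mul_le_mul_of_nonneg_left (hS i) (Real.rpow_nonneg hδ0.le _)
      _ = (δ ^ ((5:ℝ) / 3) * δ ^ ((1:ℝ) / 3)) * (2 * N + 1) ^ 2 * (ε * M) +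
          (δ ^ ((5:ℝ) / 3) * δ ^ ((1:ℝ) / 3)) * (2 * N + 1) ^ 2 * (cG * Mφ + MG * cΦ) := by ring
      _ = ((2 * (N:ℝ) + 1) ^ 2 * δ ^ 2) * (ε * M) + ((2 * (N:ℝ) + 1) ^ 2 * δ ^ 2) * (cG * Mφ + MG * cΦ) := by
          rw [hpow]; ring
      _ ≤ C₀ * (ε * M) + C₀ * (cG * Mφ + MG * cΦ) := by
          refine add_le_add (mul_le_mul_of_nonneg_right hboxR (by positivity))
            (mul_le_mul_of_nonneg_right hboxR (by positivity))
  have hsmall : C₀ * (ε * M) + C₀ * (cG * Mφ + MG * cΦ) ≤ ε₀ / 4 := by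
    have a1 : C₀ * (ε * M) ≤ ε₀ / 8 := by
      rw [hεdef]
      have : C₀ * (ε₀ / (8 * C₀ * (M + 1)) * M) = ε₀ / 8 * (M / (M + 1)) := by field_simp
      rw [this]
      have hM1 : M / (M + 1) ≤ 1 := by rw [div_le_one (by positivity)]; linarith
      calc ε₀ / 8 * (M / (M + 1)) ≤ ε₀ / 8 * 1 := by gcongr
        _ = ε₀ / 8 := mul_one _
    have a2 : C₀ * (cG * Mφ) ≤ ε₀ / 16 := by
      rw [hcGdef]
      have : C₀ * (ε₀ / (16 * C₀ * (Mφ + 1)) * Mφ) = ε₀ / 16 * (Mφ / (Mφ + 1)) := by field_simp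
      rw [this]
      have h1 : Mφ / (Mφ + 1) ≤ 1 := by rw [div_le_one (by positivity)]; linarith
      calc ε₀ / 16 * (Mφ / (Mφ + 1)) ≤ ε₀ / 16 * 1 := by gcongr
        _ = ε₀ / 16 := mul_one _
    have a3 : C₀ * (MG * cΦ) ≤ ε₀ / 16 := by
      rw [hcΦdef]
      have : C₀ * (MG * (ε₀ / (16 * C₀ * (MG + 1)))) = ε₀ / 16 * (MG / (MG + 1)) := by field_simp
      rw [this]
      have h1 : MG / (MG + 1) ≤ 1 := by rw [div_le_one (by positivity)]; linarith
      calc ε₀ / 16 * (MG / (MG + 1)) ≤ ε₀ / 16 * 1 := by gcongr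
        _ = ε₀ / 16 := mul_one _
    have : C₀ * (cG * Mφ + MG * cΦ) = C₀ * (cG * Mφ) + C₀ * (MG * cΦ) := by ring
    rw [this]; linarith only [a1, a2, a3]
  calc ‖((δ ^ ((5:ℝ) / 3) : ℝ) : ℂ) * ∑ᶠ z, obs (Λ δ) δ z *
        ((fderiv ℝ φ (medialPoint δ z) 1 + Complex.I * fderiv ℝ φ (medialPoint δ z) Complex.I) / 2)‖
      = δ ^ ((5:ℝ) / 3) * ‖∑ i : Fin 2, ∑ a ∈ box N, obs (Λ δ) δ (latEdge (a, i)) * (Wφ (P i a) / 2)‖ := by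
        rw [norm_mul, hsum, Complex.norm_real, Real.norm_eq_abs, abs_of_nonneg (Real.rpow_nonneg hδ0.le _)]
    _ ≤ δ ^ ((5:ℝ) / 3) * ∑ i : Fin 2, ‖∑ a ∈ box N, obs (Λ δ) δ (latEdge (a, i)) * (Wφ (P i a) / 2)‖ :=
        mul_le_mul_of_nonneg_left (norm_sum_le _ _) (Real.rpow_nonneg hδ0.le _)
    _ = ∑ i : Fin 2, δ ^ ((5:ℝ) / 3) * ‖∑ a ∈ box N, obs (Λ δ) δ (latEdge (a, i)) * (Wφ (P i a) / 2)‖ := by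
        rw [Finset.mul_sum]
    _ ≤ ∑ _i : Fin 2, (C₀ * (ε * M) + C₀ * (cG * Mφ + MG * cΦ)) := Finset.sum_le_sum fun i _ => hfin i
    _ = 2 * (C₀ * (ε * M) + C₀ * (cG * Mφ + MG * cΦ)) := by
        rw [Finset.sum_const, Finset.card_univ, Fintype.card_fin, nsmul_eq_mul]; push_cast; ring
    _ ≤ 2 * (ε₀ / 4) := by gcongr
    _ < ε₀ := by linarith


/-- In every holomorphic world both hypotheses of the crux hold. -/
theorem hypotheses_of_holoWorld {g : DobrushinDomain → (ℝ → DiscreteDobrushin) → ℂ → ℂ}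
    (hW : HoloWorld g) : WeakHolFamilies ∧ PrecompactFamilies :=
  ⟨weakHolFamilies_of_holoWorld hW, precompactFamilies_of_holoWorld hW⟩

/-- ONE-SIDEDNESS, SHARP FORM: in EVERY holomorphic world — whatever the profile `g` — the crux is
exactly the bare conjecture. The hypotheses (A, B) cannot tell `g = 2^{1/3}(φ'_{D,a,b})^{1/3}`
(DCS Conj. 8.7) from `g ≡ 1` or `g ≡ 0`. -/
theorem crux_iff_conjecture_of_holoWorld {g : DobrushinDomain → (ℝ → DiscreteDobrushin) → ℂ → ℂ}
    (hW : HoloWorld g) :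
    ParafermionToSLESixFamilies ↔ Literature.Probability.Percolation.SLE6LimitZ2AllDiscretisations :=
  ⟨fun h => slesixAllFamilies_iff_conjecture.1
      (crux_iff.1 h (weakHolFamilies_of_holoWorld hW) (precompactFamilies_of_holoWorld hW)),
    of_conjecture⟩

/-- Existence of at least one discretisation family of `D` with the crux's guards (the route's
support item `DiscretisationFamilyExists` restricted to the three guards used by A and B). -/
def FamilyExists (D : DobrushinDomain) : Prop :=
  ∃ Λ : ℝ → DiscreteDobrushin, (∀ δ, (Λ δ).Ω = D.carrier) ∧ (∀ δ, (Λ δ).δ = δ) ∧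
    (∀ᶠ δ in 𝓝[>] (0:ℝ), (Λ δ).IsZdAdmissible)

/-- A holomorphic world whose profile does not vanish identically (at one point of one domain
carrying a family) is NON-DEGENERATE: so `NonDegenerate ∧ A ∧ B` is exactly as uninformative about
SLE₆ as `A ∧ B` — adding the normalisation input N alone does not remove the one-sidedness; the
IDENTIFICATION of the profile is a separate missing input. -/
theorem nonDegenerate_of_holoWorld {g : DobrushinDomain → (ℝ → DiscreteDobrushin) → ℂ → ℂ}
    (hW : HoloWorld g) {D : DobrushinDomain} {Λ : ℝ → DiscreteDobrushin}
    (hΩ : ∀ δ, (Λ δ).Ω = D.carrier) (hδ : ∀ δ, (Λ δ).δ = δ)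
    (hadm : ∀ᶠ δ in 𝓝[>] (0:ℝ), (Λ δ).IsZdAdmissible)
    {z₀ : ℂ} (hz₀ : z₀ ∈ D.carrier) (hne : g D Λ z₀ ≠ 0) : NonDegenerate := by
  obtain ⟨hg, hW⟩ := hW
  set G := g D Λ with hG
  have hc₀ : 0 < ‖G z₀‖ := norm_pos_iff.2 hne
  -- a closed ball around z₀ inside D on which |G| ≥ |G z₀| / 2
  have hcont : ContinuousAt G z₀ := ((hg D Λ).continuousOn.continuousWithinAt hz₀).continuousAt
    (D.isOpen.mem_nhds hz₀)
  obtain ⟨r₁, hr₁, hr₁b⟩ := Metric.continuousAt_iff.1 hcont (‖G z₀‖ / 2) (half_pos hc₀)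
  obtain ⟨r₂, hr₂, hr₂D⟩ := Metric.isOpen_iff.1 D.isOpen z₀ hz₀
  set r : ℝ := min r₁ r₂ / 2 with hr
  have hr0 : 0 < r := by positivity
  have hrr₁ : r < r₁ := by
    have : min r₁ r₂ ≤ r₁ := min_le_left _ _
    rw [hr]; linarith
  have hrr₂ : r < r₂ := by
    have : min r₁ r₂ ≤ r₂ := min_le_right _ _
    rw [hr]; linarith
  set K : Set ℂ := Metric.closedBall z₀ r with hK
  have hKc : IsCompact K := isCompact_closedBall _ _
  have hKD : K ⊆ D.carrier := fun x hx =>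
    hr₂D (Metric.mem_ball.2 (lt_of_le_of_lt (Metric.mem_closedBall.1 hx) hrr₂))
  have hGK : ∀ x ∈ K, ‖G z₀‖ / 2 ≤ ‖G x‖ := by
    intro x hx
    have hd : dist x z₀ < r₁ := lt_of_le_of_lt (Metric.mem_closedBall.1 hx) hrr₁
    have h2 := hr₁b hd
    rw [dist_eq_norm] at h2
    have h3 := norm_sub_norm_le (G z₀) (G x)
    rw [norm_sub_rev] at h3
    linarith
  refine ⟨D, Λ, hΩ, hδ, hadm, K, hKc, hKD, ‖G z₀‖ / 4, by positivity, ?_⟩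
  have hev := hW D Λ hΩ hδ hadm K hKc hKD (‖G z₀‖ / 4) (by positivity)
  have hsmall : Set.Ioo (0:ℝ) (r / 3) ∈ 𝓝[>] (0:ℝ) := Ioo_mem_nhdsGT (by positivity)
  refine Filter.Eventually.frequently ?_
  filter_upwards [hev, hsmall] with δ h hδI
  obtain ⟨hδ0, hδr⟩ := hδI
  -- the lattice edge next to z₀
  set a : Site 2 := ![⌊z₀.re / δ⌋, ⌊z₀.im / δ⌋] with ha
  have hre : (medialPoint δ s(a, a + Pi.single 0 1)).re = δ * ⌊z₀.re / δ⌋ + δ / 2 := by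
    rw [medialPoint_mk, Complex.div_ofNat_re, Complex.add_re, meshPoint_re, meshPoint_re, Pi.add_apply]
    simp [ha]
    ring
  have him : (medialPoint δ s(a, a + Pi.single 0 1)).im = δ * ⌊z₀.im / δ⌋ := by
    rw [medialPoint_mk, Complex.div_ofNat_im, Complex.add_im, meshPoint_im, meshPoint_im, Pi.add_apply]
    simp [ha]
  have hfl : ∀ x : ℝ, |δ * ⌊x / δ⌋ - x| ≤ δ := by
    intro x
    have h1 : (⌊x / δ⌋ : ℝ) ≤ x / δ := Int.floor_le _
    have h2 : x / δ < ⌊x / δ⌋ + 1 := Int.lt_floor_add_one _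
    have e : δ * (x / δ) = x := mul_div_cancel₀ x hδ0.ne'
    rw [abs_le]; constructor <;> nlinarith
  have hdist : dist (medialPoint δ s(a, a + Pi.single 0 1)) z₀ ≤ r := by
    rw [Complex.dist_eq]
    refine (Complex.norm_le_abs_re_add_abs_im _).trans ?_
    rw [Complex.sub_re, Complex.sub_im, hre, him]
    have h1 : |δ * ⌊z₀.re / δ⌋ + δ / 2 - z₀.re| ≤ δ + δ / 2 := by
      calc |δ * ⌊z₀.re / δ⌋ + δ / 2 - z₀.re| = |(δ * ⌊z₀.re / δ⌋ - z₀.re) + δ / 2| := by ring_nf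
        _ ≤ |δ * ⌊z₀.re / δ⌋ - z₀.re| + |δ / 2| := abs_add_le _ _
        _ ≤ δ + δ / 2 := add_le_add (hfl _) (by rw [abs_of_pos (by positivity)])
    have h2 := hfl z₀.im
    linarith
  have hzK : medialPoint δ s(a, a + Pi.single 0 1) ∈ K := Metric.mem_closedBall.2 hdist
  refine ⟨s(a, a + Pi.single 0 1), latEdge_mem_edgeSet (a, 0), hzK, ?_⟩
  have hb := h _ (latEdge_mem_edgeSet (a, 0)) hzK
  have hpos : 0 < δ ^ ((1:ℝ) / 3) := Real.rpow_pos_of_pos hδ0 _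
  have hnorm : ‖((δ ^ ((1:ℝ) / 3) : ℝ) : ℂ) * G (medialPoint δ s(a, a + Pi.single 0 1))‖ ≥
      δ ^ ((1:ℝ) / 3) * (‖G z₀‖ / 2) := by
    rw [norm_mul, Complex.norm_real, Real.norm_eq_abs, abs_of_pos hpos]
    exact mul_le_mul_of_nonneg_left (hGK _ hzK) hpos.le
  have h1 := norm_sub_norm_le (((δ ^ ((1:ℝ) / 3) : ℝ) : ℂ) * G (medialPoint δ s(a, a + Pi.single 0 1)))
    (obs (Λ δ) δ s(a, a + Pi.single 0 1))
  rw [norm_sub_rev] at h1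
  have hb' : ‖obs (Λ δ) δ s(a, a + Pi.single 0 1) -
      ((δ ^ ((1:ℝ) / 3) : ℝ) : ℂ) * G (medialPoint δ s(a, a + Pi.single 0 1))‖ ≤ ‖G z₀‖ / 4 * δ ^ ((1:ℝ) / 3) := hb
  change ‖G z₀‖ / 4 * δ ^ ((1:ℝ) / 3) ≤ ‖obs (Λ δ) δ s(a, a + Pi.single 0 1)‖
  linarith [hb', hnorm, h1]

/-- Hence, for a profile that is non-zero somewhere on a domain carrying a family, the holomorphic
world satisfies `NonDegenerate ∧ A ∧ B` and STILL leaves the crux equal to the bare conjecture. -/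
theorem oneSided_even_with_nonDegeneracy {g : DobrushinDomain → (ℝ → DiscreteDobrushin) → ℂ → ℂ}
    (hW : HoloWorld g) {D : DobrushinDomain} {Λ : ℝ → DiscreteDobrushin}
    (hΩ : ∀ δ, (Λ δ).Ω = D.carrier) (hδ : ∀ δ, (Λ δ).δ = δ)
    (hadm : ∀ᶠ δ in 𝓝[>] (0:ℝ), (Λ δ).IsZdAdmissible)
    {z₀ : ℂ} (hz₀ : z₀ ∈ D.carrier) (hne : g D Λ z₀ ≠ 0) :
    NonDegenerate ∧ WeakHolFamilies ∧ PrecompactFamilies ∧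
      (ParafermionToSLESixFamilies ↔ Literature.Probability.Percolation.SLE6LimitZ2AllDiscretisations) :=
  ⟨nonDegenerate_of_holoWorld hW hΩ hδ hadm hz₀ hne, weakHolFamilies_of_holoWorld hW,
    precompactFamilies_of_holoWorld hW, crux_iff_conjecture_of_holoWorld hW⟩

/-- Example profile: the constant world `g ≡ 1` is a holomorphic profile (so, granted the world,
`NonDegenerate ∧ A ∧ B` hold on any domain carrying a family while the crux is the conjecture). -/
theorem differentiableOn_constWorld (D : DobrushinDomain) (Λ : ℝ → DiscreteDobrushin) :
    DifferentiableOn ℂ ((fun (_ : DobrushinDomain) (_ : ℝ → DiscreteDobrushin) (_ : ℂ) => (1 : ℂ)) D Λ) D.carrier :=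
  differentiableOn_const 1

end Summit.CriticalPhenomena.CardyFormulaZ2.Cruxes.ParafermionToSLESixFamilies.Disproof

end
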